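import Literature.Probability.LatticeModels.FieldScalingLimitPlusBoxProofs
import Literature.Probability.LatticeModels.MessagerMiracleSole
import Literature.Probability.LatticeModels.LebowitzInequality
import Literature.Probability.LatticeModels.IsingMonotonicity
import Literature.Probability.LatticeModels.IsingLimitLawProofs
import Literature.Probability.LatticeModels.HighDimTrivialityCorrLengthWindow
import Mathlib.MeasureTheory.Constructions.HaarToSphere
import Mathlib.MeasureTheory.Measure.Haar.InnerProductSpace
import Mathlib.MeasureTheory.Measure.Haar.NormedSpace
import Mathlib.Analysis.SpecialFunctions.Integrals.Basic
import Mathlib.MeasureTheory.Group.Integral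
import Mathlib.Analysis.Calculus.BumpFunction.FiniteDimension
import Mathlib.Analysis.Distribution.SchwartzSpace.Deriv
import Mathlib.Analysis.SpecificLimits.Basic
import HarnessLib

/-!
# crit-ising.S13 in its plus-box rendering: the plus boundary is invisible at the smearing scale

Third proof companion of `Literature/Probability/LatticeModels/FieldScalingLimit.lean` for
`Literature.Probability.LatticeModels.highDim_triviality` (theorems only: no definition of that
file is changed, no statement and no named fact is introduced; the auxiliary `def`s below —
orthant bookkeeping, bump functions, the Schwartz majorant — are proof devices).

`highDim_triviality` smears the FINITE-VOLUME PLUS measures `μ⁺_{box d (L δ); β(δ), 0}` in the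
joint regime `δ L(δ) → ∞`, whereas every source (Aizenman–Duminil-Copin, Ann. Math. 194 (2021),
Def. 1.1 / Thm 1.2; Aizenman, CMP 86 (1982), (13.1); Panis 2023, Thm 5.5) treats the
infinite-volume state, whose smeared laws are even. `FieldScalingLimitPlusBoxProofs` reduced the
rendered statement to the printed one GIVEN that the renormalised plus-boundary magnetisation
functional `M_δ(f) = ∑_{x ∈ box} |ρ(δ) δᵈ f(δx)| ⟨σₓ⟩⁺_{box; β(δ), 0}` vanishes for every test
function (`highDim_triviality_plus_of_five_le`, `highDim_triviality_plus`). **This file proves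
that `M_δ(f) → 0` follows from the hypotheses of `highDim_triviality` themselves** — convergence
in law of the plus-box laws to a law `μ` with bounded non-degenerate two-point function — using
only printed, tree-resident correlation inequalities; hence the plus-box rendering of
crit-ising.S13 holds: `highDim_triviality_of_five_le` (`d ≥ 5`, unconditional) and
`highDim_triviality_of_panisFour` (`d ≥ 4`, from the named fact `panis_ursellFourSum_le_four`,
which enters at `d = 4` exactly as in the corrected infinite-volume form
`highDim_triviality_gibbs`). The argument (all of it elementary given the tree; no step of it is
claimed to be printed in this form):

* **A. One-point Messager–Miracle-Solé monotonicity for plus boxes.** `⟨σ_x⟩⁺_{Λ_L} ≤ ⟨σ_{x+eᵢ}⟩⁺_{Λ_L}`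
  for `xᵢ ≥ 0`: fold the symmetrised box `Λ_L ∪ θΛ_L` along the reflection `θ` through
  `{yᵢ = xᵢ + ½}` (the tree's `sum_foldedClass_mul_isingWeight_nonneg`, `axisRefl`, after
  Messager–Miracle-Solé, J. Stat. Phys. 17 (1977) and Hegerfeldt, CMP 57 (1977)); the frozen region
  `θΛ_L ∖ Λ_L` lies on the far side and its indicator `∏ (1 + s_y + t_y)/2` is a nonnegative
  combination of folded monomials; the conditioning identity is that of Friedli–Velenik 2017,
  Lemma 3.22 (`IsingMonotonicity`).
* **B. Kurtosis with fields.** Lebowitz' bound on the covariance of pair observables holds WITH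
  nonnegative fields (`gksExpect_cov_spinPair_le` of `LebowitzInequality`; Glimm–Jaffe 1987,
  Cor. 4.3.2), so `⟨X⁴⟩⁺ ≤ 5 ⟨X²⟩⁺²` for `X = ∑ cₓσₓ`, `cₓ ≥ 0`, under the plus box — for the
  UNCENTRED moments; this replaces the evenness used in print to pin the scale.
* **C–D. Tightness pins scale and mean.** Along `δ → 0⁺` the marginal laws of `ω(g)` converge
  (Lévy, `tendsto_marginal_of_tendstoInLaw`); Paley–Zygmund with B and Chebyshev for the limit give,
  for every `g ≥ 0`, eventually `⟨X_g²⟩⁺ ≤ 80 (∫ ω(g)² dμ + 1)` and hence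
  `𝔪_δ(g)² ≤ 80 (∫ ω(g)² dμ + 1)` for `𝔪_δ(g) = |ρ| δᵈ ∑ g(δx) ⟨σₓ⟩⁺` (quantitative form of the
  tree's `eventually_variance_le_of_tendsto`).
* **E. Riesz scaling.** `|S₂(x,y)| ≤ C‖x−y‖^{2−d}` gives `∫ ω(χ_T)² dμ = O(T^{d+2})` for bumps of
  scale `T` (polar coordinates, Mathlib `integral_fun_norm_addHaar`).
* **F. Packing.** By A the magnetisation profile increases outwards, so `kᵈ` disjoint outward
  translates of the near cube of continuum side `R` fit inside the plateau of `χ_T`,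
  `T = (k+1)(2R+3)`: `kᵈ 𝔪_δ(1_{near}) ≤ 𝔪_δ(χ_T) ≲ T^{d/2+1}`, i.e. `𝔪_δ(1_{near}) ≲ k^{1−d/2} → 0`
  (`d ≥ 3`).
* **G. Far region.** Every Schwartz `f` is `o(G)` for a Schwartz `G ≥ 0` (dyadic sum of bumps
  weighted by `√(sup_{‖z‖≥2ʲ}|f|)`), and `𝔪_δ(G)` is eventually bounded by D.
* **H. Assembly**, and the two headline theorems via `FieldScalingLimitPlusBoxProofs`.

References: A. Messager, S. Miracle-Solé, J. Stat. Phys. 17 (1977) 245–262 (main theorem);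
G. C. Hegerfeldt, Comm. Math. Phys. 57 (1977) 259–266 (Thm. 3.1); J. Glimm, A. Jaffe, *Quantum
Physics* (2nd ed. 1987), Cor. 4.3.2–4.3.3 (Lebowitz inequality); S. Friedli, Y. Velenik,
*Statistical Mechanics of Lattice Systems* (CUP 2017), §3.6–3.8, Lemma 3.22; M. Aizenman,
H. Duminil-Copin, Ann. Math. 194 (2021) = arXiv:1912.07973, Def. 1.1, Thm 1.2 (p. 4), Prop. 1.4
(p. 6); M. Aizenman, Comm. Math. Phys. 86 (1982), Prop. 10.1, (13.1); R. Panis, arXiv:2309.05797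
(2023), Thm 5.5, Cor. 1.8; G. B. Folland, *Real Analysis* (1999), Cor. 2.51 (polar coordinates).
All auxiliary statements are proof devices ([folklore]); no new named facts (D-0026).
-/

noncomputable section

open scoped SchwartzMap
open scoped Finset
open MeasureTheory Filter Topology ProbabilityTheory
open Literature.MathematicalPhysics.QuantumLattice
open Literature.MathematicalPhysics.QuantumFieldTheory

namespace Literature.Probability.LatticeModels

/-! ### A. The one-point Messager–Miracle-Solé inequality for plus boxes

The magnetisation profile of a plus box increases towards the boundary: the reflection through a
half-integer lattice hyperplane folds the symmetrised box `Λ ∪ θΛ` (plus boundary condition), the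
frozen region `θΛ ∖ Λ` being the indicator `∏ (1 + σ_y)/2 = ∏ (1 + s_y + t_y)/2`, a nonnegative
combination of folded monomials on the positive side, so that Griffiths' first inequality in the
even/odd variables (`sum_foldedClass_mul_isingWeight_nonneg`) gives `⟨σ_u - σ_{θu} ; frozen⟩ ≥ 0`. -/

section OnePointMMS

variable {V : Type*} [DecidableEq V] (G : SimpleGraph V) [G.LocallyFinite]
variable {θ : V ≃ V} {P : V → Prop} [DecidablePred P] {Λ : Finset V}

/-- **GKS I for the folded plus state with a frozen region on the positive side.** In the setting
of `sum_foldedClass_mul_isingWeight_nonneg` (a `θ`-symmetric volume `Λ` with `+` boundary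
condition, `β, h ≥ 0`), for every `S ⊆ Λ` contained in the positive side and every folded
monomial `M`: `∑_ω M(ω) 1{ω ≡ +1 on S} e^{-βH(ω·+)} ≥ 0`, since
`1{σ_y = 1} = (1 + s_y + t_y)/2` (Messager–Miracle-Solé 1977, proof of the main theorem, with
Friedli–Velenik 2017, §3.6.2 for the indicator). [cite: MessagerMiracleSoleJSP1977, main theorem (monotonicity of ⟨σ₀σ_x⟩ under reflections)] -/
theorem sum_foldedClass_mul_plusIndicator_mul_isingWeight_nonneg (hθ : Function.Involutive θ)
    (hadj : ∀ x y, G.Adj (θ x) (θ y) ↔ G.Adj x y) (hPθ : ∀ x, P x → ¬P (θ x))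
    (hfix : ∀ x, ¬P x → ¬P (θ x) → θ x = x)
    (hedge : ∀ x y, G.Adj x y → P x → ¬P y → θ y ≠ y → y = θ x)
    (hΛ : ∀ x, x ∈ Λ ↔ θ x ∈ Λ) {β h : ℝ} (hβ : 0 ≤ β) (hh : 0 ≤ h)
    {S : Finset V} (hSΛ : S ⊆ Λ) (hSP : ∀ y ∈ S, P y) :
    ∀ M ∈ foldedClass (volInvol θ Λ hΛ) (volSide P Λ),
      0 ≤ ∑ ω, M ω * plusIndicator S (glue Λ ω .plus) * isingWeight G Λ β h .plus ω := by
  induction S using Finset.induction_on with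
  | empty =>
    intro M hM
    simpa [plusIndicator] using
      sum_foldedClass_mul_isingWeight_nonneg G hθ hadj hPθ hfix hedge hΛ hβ hh M hM
  | insert y S hyS ih =>
    intro M hM
    have hy : y ∈ Λ := hSΛ (Finset.mem_insert_self y S)
    have hPy : P y := hSP y (Finset.mem_insert_self y S)
    have ih' := ih ((Finset.subset_insert y S).trans hSΛ)
      (fun z hz => hSP z (Finset.mem_insert_of_mem hz))
    set θv := volInvol θ Λ hΛ with hθv
    set uy : ↥Λ := ⟨y, hy⟩ with huy
    have hPy' : uy ∈ volSide P Λ := (mem_volSide P Λ).2 hPy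
    have key : ∀ ω : SpinConfig ↥Λ,
        M ω * plusIndicator (insert y S) (glue Λ ω .plus) * isingWeight G Λ β h .plus ω =
          (1 / 2) * (M ω * plusIndicator S (glue Λ ω .plus) * isingWeight G Λ β h .plus ω) +
          (1 / 2) * ((M ω * sVar θv uy ω) * plusIndicator S (glue Λ ω .plus) *
            isingWeight G Λ β h .plus ω) +
          (1 / 2) * ((M ω * tVar θv uy ω) * plusIndicator S (glue Λ ω .plus) *
            isingWeight G Λ β h .plus ω) := by
      intro ω
      rw [plusIndicator, Finset.prod_insert hyS, ← plusIndicator, spinAt_glue_of_mem ω _ hy,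
        spinAt_eq_sVar_add_tVar θv uy]
      ring
    simp_rw [key]
    rw [Finset.sum_add_distrib, Finset.sum_add_distrib, ← Finset.mul_sum, ← Finset.mul_sum,
      ← Finset.mul_sum]
    refine add_nonneg (add_nonneg ?_ ?_) ?_
    · exact mul_nonneg (by norm_num) (ih' M hM)
    · exact mul_nonneg (by norm_num)
        (ih' _ (mul_mem_foldedClass _ _ hM (sVar_mem_foldedClass _ _ hPy')))
    · exact mul_nonneg (by norm_num)
        (ih' _ (mul_mem_foldedClass _ _ hM (tVar_mem_foldedClass _ _ hPy')))

/-- **The one-point Messager–Miracle-Solé inequality for a plus volume with a frozen region.**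
Let `θ` be an involutive automorphism of the graph, `Λ` a `θ`-stable volume with positive side
`P` as in `sum_foldedClass_mul_isingWeight_nonneg`, and `Λ₀ ⊆ Λ` a sub-volume whose complement
`Λ ∖ Λ₀` lies on the positive side. Then for the `+` boundary condition on `Λ₀`, `β, h ≥ 0`, and
`u, θu ∈ Λ₀` with `u` on the positive side: `⟨σ_{θu}⟩⁺_{Λ₀;β,h} ≤ ⟨σ_u⟩⁺_{Λ₀;β,h}` — the spins
on the side of the frozen `+` region are more magnetised. Proof: `μ⁺_{Λ₀} = μ⁺_Λ(· | σ ≡ +1 on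
Λ ∖ Λ₀)` (Friedli–Velenik 2017, proof of Lemma 3.22) and `σ_u - σ_{θu} = 2t_u`, so the claim is
`sum_foldedClass_mul_plusIndicator_mul_isingWeight_nonneg` (Messager–Miracle-Solé 1977, main
theorem: `⟨σ_A⟩ ≥ ⟨σ_{θA}⟩` when the asymmetric part of the ferromagnetic interaction lies on the
side of `A`; here `A = {u}` and the asymmetric part is the frozen region).
[cite: MessagerMiracleSoleJSP1977, main theorem (monotonicity of ⟨σ₀σ_x⟩ under reflections)] [cite: FriedliVelenik2017, Lemma 3.22 (proof), p. 111] -/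
theorem isingExpect_plus_spinAt_reflect_le_of_frozen (hθ : Function.Involutive θ)
    (hadj : ∀ x y, G.Adj (θ x) (θ y) ↔ G.Adj x y) (hPθ : ∀ x, P x → ¬P (θ x))
    (hfix : ∀ x, ¬P x → ¬P (θ x) → θ x = x)
    (hedge : ∀ x y, G.Adj x y → P x → ¬P y → θ y ≠ y → y = θ x)
    (hΛ : ∀ x, x ∈ Λ ↔ θ x ∈ Λ) {β h : ℝ} (hβ : 0 ≤ β) (hh : 0 ≤ h)
    {Λ₀ : Finset V} (h0 : Λ₀ ⊆ Λ) (hfro : ∀ y ∈ Λ \ Λ₀, P y)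
    {u : V} (hu : u ∈ Λ₀) (hθu : θ u ∈ Λ₀) (hPu : P u) :
    isingExpect G Λ₀ β h .plus (spinAt (θ u)) ≤ isingExpect G Λ₀ β h .plus (spinAt u) := by
  set F : SpinConfig V → ℝ := fun σ => spinAt u σ - spinAt (θ u) σ with hF
  have hFm : Measurable F := (measurable_spinAt u).sub (measurable_spinAt (θ u))
  -- positivity of the frozen folded sum
  set θv := volInvol θ Λ hΛ with hθv
  have huΛ : u ∈ Λ := h0 hu
  have hθuΛ : θ u ∈ Λ := h0 hθu
  set uu : ↥Λ := ⟨u, huΛ⟩ with huu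
  have hPu' : uu ∈ volSide P Λ := (mem_volSide P Λ).2 hPu
  have hpos : 0 ≤ ∑ ω : SpinConfig ↥Λ, tVar θv uu ω * plusIndicator (Λ \ Λ₀) (glue Λ ω .plus) *
      isingWeight G Λ β h .plus ω :=
    sum_foldedClass_mul_plusIndicator_mul_isingWeight_nonneg G hθ hadj hPθ hfix hedge hΛ hβ hh
      Finset.sdiff_subset (fun y hy => hfro y hy) _ (tVar_mem_foldedClass _ _ hPu')
  -- `F(glue Λ ω) = 2 t_u(ω)`
  have hFglue : ∀ ω : SpinConfig ↥Λ, F (glue Λ ω .plus) = 2 * tVar θv uu ω := by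
    intro ω
    simp only [hF]
    rw [spinAt_glue_of_mem ω _ huΛ, spinAt_glue_of_mem ω _ hθuΛ,
      show spinAt (⟨θ u, hθuΛ⟩ : ↥Λ) ω = spinAt (θv uu) ω from rfl, tVar]
    ring
  -- the restricted `Λ`-sum is a positive multiple of the `Λ₀`-sum (Friedli–Velenik, Lemma 3.22)
  have hsum : ∑ ω : SpinConfig ↥Λ, isingWeight G Λ β h .plus ω * F (glue Λ ω .plus) *
      plusIndicator (Λ \ Λ₀) (glue Λ ω .plus) =
      Real.exp (β * ((#(edgesTouching G Λ \ edgesTouching G Λ₀) : ℝ) + h * #(Λ \ Λ₀))) *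
        ∑ τ' : SpinConfig ↥Λ₀, isingWeight G Λ₀ β h .plus τ' * F (glue Λ₀ τ' .plus) := by
    rw [sum_mul_plusIndicator_glue h0 (fun ω => isingWeight G Λ β h .plus ω * F (glue Λ ω .plus)),
      Finset.mul_sum]
    refine Finset.sum_congr rfl fun τ' _ => ?_
    rw [isingWeight_plus_extendOne G h0, glue_extendOne h0]
    ring
  have hsum' : ∑ ω : SpinConfig ↥Λ, isingWeight G Λ β h .plus ω * F (glue Λ ω .plus) *
      plusIndicator (Λ \ Λ₀) (glue Λ ω .plus) =
      2 * ∑ ω : SpinConfig ↥Λ, tVar θv uu ω * plusIndicator (Λ \ Λ₀) (glue Λ ω .plus) *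
        isingWeight G Λ β h .plus ω := by
    rw [Finset.mul_sum]
    refine Finset.sum_congr rfl fun ω _ => ?_
    rw [hFglue ω]
    ring
  have h0sum : 0 ≤ ∑ τ' : SpinConfig ↥Λ₀, isingWeight G Λ₀ β h .plus τ' * F (glue Λ₀ τ' .plus) := by
    have h2 : 0 ≤ Real.exp (β * ((#(edgesTouching G Λ \ edgesTouching G Λ₀) : ℝ) + h * #(Λ \ Λ₀))) *
        ∑ τ' : SpinConfig ↥Λ₀, isingWeight G Λ₀ β h .plus τ' * F (glue Λ₀ τ' .plus) := by
      rw [← hsum, hsum']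
      exact mul_nonneg two_pos.le hpos
    exact nonneg_of_mul_nonneg_right (by rwa [mul_comm] at h2) (Real.exp_pos _)
  -- conclude
  rw [← sub_nonneg]
  have hexp : isingExpect G Λ₀ β h .plus (spinAt u) - isingExpect G Λ₀ β h .plus (spinAt (θ u)) =
      isingExpect G Λ₀ β h .plus F := by
    rw [isingExpect_eq_sum_div G Λ₀ h .plus β (measurable_spinAt u),
      isingExpect_eq_sum_div G Λ₀ h .plus β (measurable_spinAt (θ u)),
      isingExpect_eq_sum_div G Λ₀ h .plus β hFm, ← sub_div, ← Finset.sum_sub_distrib]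
    congr 1
    refine Finset.sum_congr rfl fun τ _ => ?_
    simp only [hF]
    ring
  rw [hexp, isingExpect_eq_sum_div G Λ₀ h .plus β hFm]
  exact div_nonneg h0sum (isingPartitionFunction_pos G Λ₀ β h .plus).le

end OnePointMMS

/-! #### Plus boxes of `ℤᵈ`: the magnetisation profile increases towards the boundary -/

section ZdBoxes

variable {d : ℕ}

/-- **The plus magnetisation profile of a box increases along each coordinate half-axis**
(Messager–Miracle-Solé 1977, main theorem, one-point case for the `+` box; Hegerfeldt 1977,
Thm. 3.1): for `β ≥ 0`, `h ≥ 0`, `x, x + eᵢ ∈ box d L` with `xᵢ ≥ 0`,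
`⟨σ_x⟩⁺_{box d L;β,h} ≤ ⟨σ_{x+eᵢ}⟩⁺_{box d L;β,h}`. Reflection through `{yᵢ = xᵢ + ½}` folds the
symmetrised box `Λ(L) ∪ θΛ(L)`, whose part outside `Λ(L)` is frozen to `+1` and lies on the far
side. [cite: MessagerMiracleSoleJSP1977, main theorem (monotonicity of ⟨σ₀σ_x⟩ under reflections)] [cite: Hegerfeldt1977, Thm. 3.1, eq. (3.8)] -/
theorem isingExpect_plus_spinAt_le_add_single {β h : ℝ} (hβ : 0 ≤ β) (hh : 0 ≤ h) {L : ℕ}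
    {x : Site d} (i : Fin d) (hxi : 0 ≤ x i) (hx : x ∈ box d L)
    (hx' : x + Pi.single i 1 ∈ box d L) :
    isingExpect (zdGraph d) (box d L) β h .plus (spinAt x) ≤
      isingExpect (zdGraph d) (box d L) β h .plus (spinAt (x + Pi.single i 1)) := by
  classical
  set k : ℤ := 2 * x i + 1 with hk
  set θ : Site d ≃ Site d := axisRefl i k with hθdef
  have hθ : Function.Involutive θ := axisRefl_involutive i k
  have hθx : θ (x + Pi.single i 1) = x := by
    funext j
    rw [hθdef, axisRefl_apply, Pi.add_apply]
    by_cases hj : j = i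
    · subst hj; simp [hk]; ring
    · simp [hj]
  -- the far side `P = {2yᵢ > k}`
  let P : Site d → Prop := fun y => k < 2 * y i
  have hPθ : ∀ y, P y → ¬P (θ y) := by
    intro y hy
    simp only [P, hθdef, axisRefl_apply, if_true, not_lt]
    simp only [P] at hy
    omega
  have hfix : ∀ y, ¬P y → ¬P (θ y) → θ y = y := by
    intro y hy hθy
    simp only [P, hθdef, axisRefl_apply, if_true, not_lt] at hy hθy
    exfalso
    omega
  have hedge : ∀ y z, (zdGraph d).Adj y z → P y → ¬P z → θ z ≠ z → z = θ y := by
    intro y z hyz hy hz _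
    simp only [P, not_lt] at hy hz
    obtain ⟨l, hl, hrest⟩ := zdGraph_adj_coord hyz
    funext m
    rw [hθdef, axisRefl_apply]
    by_cases hm : m = i
    · subst hm
      rw [if_pos rfl]
      by_cases hlm : l = m
      · subst hlm
        omega
      · have := hrest m (Ne.symm hlm)
        omega
    · rw [if_neg hm]
      by_cases hlm : l = m
      · subst hlm
        have := hrest i (Ne.symm hm)
        omega
      · exact hrest m (Ne.symm hlm)
  -- the symmetrised box and its frozen part
  have hΛ : ∀ y, y ∈ symBox θ L ↔ θ y ∈ symBox θ L := fun y => mem_symBox_iff hθ y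
  have hxiL : x i + 1 ≤ L := by
    have := (mem_box.1 hx' i).2
    simp at this
    omega
  have hfro : ∀ y ∈ symBox θ L \ box d L, P y := by
    intro y hy
    rw [Finset.mem_sdiff] at hy
    obtain ⟨hyS, hyb⟩ := hy
    rcases Finset.mem_union.1 hyS with h' | h'
    · exact absurd h' hyb
    · obtain ⟨z, hz, rfl⟩ := Finset.mem_map.1 h'
      change z ∈ box d L at hz
      simp only [P, Equiv.toEmbedding_apply, hθdef, axisRefl_apply, if_true]
      -- `θ z ∉ box`, so its `i`-th coordinate `k - zᵢ` exceeds `L`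
      have hzi := mem_box.1 hz i
      have hout : ¬ (-(L : ℤ) ≤ k - z i ∧ k - z i ≤ L) := by
        intro hc
        apply hyb
        rw [mem_box]
        intro j
        change -(L : ℤ) ≤ axisRefl i k z j ∧ axisRefl i k z j ≤ L
        rw [axisRefl_apply]
        by_cases hj : j = i
        · subst hj; rw [if_pos rfl]; exact hc
        · rw [if_neg hj]; exact mem_box.1 hz j
      omega
  have hPu : P (x + Pi.single i 1) := by
    simp only [P, Pi.add_apply, Pi.single_eq_same, hk]
    omega
  have h := isingExpect_plus_spinAt_reflect_le_of_frozen (zdGraph d) (P := P) hθ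
    (zdGraph_adj_axisRefl i k) hPθ hfix hedge hΛ hβ hh (box_subset_symBox θ L) hfro hx'
    (by rwa [hθx]) hPu
  rwa [hθx] at h

/-- The same along the negative half-axis: for `xᵢ ≤ 0` and `x, x - eᵢ ∈ box d L`,
`⟨σ_x⟩⁺_{box d L;β,h} ≤ ⟨σ_{x-eᵢ}⟩⁺_{box d L;β,h}` (reflection through `{yᵢ = xᵢ - ½}`). [cite: MessagerMiracleSoleJSP1977, main theorem (monotonicity of ⟨σ₀σ_x⟩ under reflections)] -/
theorem isingExpect_plus_spinAt_le_sub_single {β h : ℝ} (hβ : 0 ≤ β) (hh : 0 ≤ h) {L : ℕ}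
    {x : Site d} (i : Fin d) (hxi : x i ≤ 0) (hx : x ∈ box d L)
    (hx' : x - Pi.single i 1 ∈ box d L) :
    isingExpect (zdGraph d) (box d L) β h .plus (spinAt x) ≤
      isingExpect (zdGraph d) (box d L) β h .plus (spinAt (x - Pi.single i 1)) := by
  classical
  set k : ℤ := 2 * x i - 1 with hk
  set θ : Site d ≃ Site d := axisRefl i k with hθdef
  have hθ : Function.Involutive θ := axisRefl_involutive i k
  have hθx : θ (x - Pi.single i 1) = x := by
    funext j
    rw [hθdef, axisRefl_apply, Pi.sub_apply]
    by_cases hj : j = i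
    · subst hj; simp [hk]; ring
    · simp [hj]
  -- the far side `P = {2yᵢ < k}`
  let P : Site d → Prop := fun y => 2 * y i < k
  have hPθ : ∀ y, P y → ¬P (θ y) := by
    intro y hy
    simp only [P, hθdef, axisRefl_apply, if_true, not_lt]
    simp only [P] at hy
    omega
  have hfix : ∀ y, ¬P y → ¬P (θ y) → θ y = y := by
    intro y hy hθy
    simp only [P, hθdef, axisRefl_apply, if_true, not_lt] at hy hθy
    exfalso
    omega
  have hedge : ∀ y z, (zdGraph d).Adj y z → P y → ¬P z → θ z ≠ z → z = θ y := by
    intro y z hyz hy hz _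
    simp only [P, not_lt] at hy hz
    obtain ⟨l, hl, hrest⟩ := zdGraph_adj_coord hyz
    funext m
    rw [hθdef, axisRefl_apply]
    by_cases hm : m = i
    · subst hm
      rw [if_pos rfl]
      by_cases hlm : l = m
      · subst hlm
        omega
      · have := hrest m (Ne.symm hlm)
        omega
    · rw [if_neg hm]
      by_cases hlm : l = m
      · subst hlm
        have := hrest i (Ne.symm hm)
        omega
      · exact hrest m (Ne.symm hlm)
  have hΛ : ∀ y, y ∈ symBox θ L ↔ θ y ∈ symBox θ L := fun y => mem_symBox_iff hθ y
  have hxiL : -(L : ℤ) ≤ x i - 1 := by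
    have := (mem_box.1 hx' i).1
    simp at this
    omega
  have hfro : ∀ y ∈ symBox θ L \ box d L, P y := by
    intro y hy
    rw [Finset.mem_sdiff] at hy
    obtain ⟨hyS, hyb⟩ := hy
    rcases Finset.mem_union.1 hyS with h' | h'
    · exact absurd h' hyb
    · obtain ⟨z, hz, rfl⟩ := Finset.mem_map.1 h'
      change z ∈ box d L at hz
      simp only [P, Equiv.toEmbedding_apply, hθdef, axisRefl_apply, if_true]
      have hzi := mem_box.1 hz i
      have hout : ¬ (-(L : ℤ) ≤ k - z i ∧ k - z i ≤ L) := by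
        intro hc
        apply hyb
        rw [mem_box]
        intro j
        change -(L : ℤ) ≤ axisRefl i k z j ∧ axisRefl i k z j ≤ L
        rw [axisRefl_apply]
        by_cases hj : j = i
        · subst hj; rw [if_pos rfl]; exact hc
        · rw [if_neg hj]; exact mem_box.1 hz j
      omega
  have hPu : P (x - Pi.single i 1) := by
    simp only [P, Pi.sub_apply, Pi.single_eq_same, hk]
    omega
  have h := isingExpect_plus_spinAt_reflect_le_of_frozen (zdGraph d) (P := P) hθ
    (zdGraph_adj_axisRefl i k) hPθ hfix hedge hΛ hβ hh (box_subset_symBox θ L) hfro hx'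
    (by rwa [hθx]) hPu
  rwa [hθx] at h

/-- **Outward translations increase the plus magnetisation inside a box** (iteration of the
one-point Messager–Miracle-Solé inequality): for `β, h ≥ 0`, `x ∈ box d L` and a lattice vector
`b` pointing away from every coordinate hyperplane through `x` (`xᵢ bᵢ ≥ 0`, and `xᵢ = 0`
unrestricted) with `x + b ∈ box d L`: `⟨σ_x⟩⁺_{box d L} ≤ ⟨σ_{x+b}⟩⁺_{box d L}`. [cite: MessagerMiracleSoleJSP1977, main theorem (monotonicity of ⟨σ₀σ_x⟩ under reflections)] -/
theorem isingExpect_plus_spinAt_le_add_of_outward {β h : ℝ} (hβ : 0 ≤ β) (hh : 0 ≤ h) {L : ℕ}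
    {x b : Site d} (hx : x ∈ box d L) (hxb : x + b ∈ box d L)
    (hsign : ∀ i, (0 ≤ x i ∧ 0 ≤ b i) ∨ (x i ≤ 0 ∧ b i ≤ 0)) :
    isingExpect (zdGraph d) (box d L) β h .plus (spinAt x) ≤
      isingExpect (zdGraph d) (box d L) β h .plus (spinAt (x + b)) := by
  classical
  -- induction on the total number of unit steps `∑ᵢ |bᵢ|`
  suffices H : ∀ n : ℕ, ∀ x b : Site d, (∑ i, (b i).natAbs) = n → x ∈ box d L → x + b ∈ box d L →
      (∀ i, (0 ≤ x i ∧ 0 ≤ b i) ∨ (x i ≤ 0 ∧ b i ≤ 0)) →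
      isingExpect (zdGraph d) (box d L) β h .plus (spinAt x) ≤
        isingExpect (zdGraph d) (box d L) β h .plus (spinAt (x + b)) from
    H _ x b rfl hx hxb hsign
  intro n
  induction n with
  | zero =>
    intro x b hb _ _ _
    have hb0 : b = 0 := by
      funext i
      have := (Finset.sum_eq_zero_iff.1 hb) i (Finset.mem_univ i)
      simpa using this
    simp [hb0]
  | succ n ih =>
    intro x b hb hx hxb hsign
    -- pick a coordinate with `bᵢ ≠ 0`
    obtain ⟨i, hi⟩ : ∃ i, b i ≠ 0 := by
      by_contra hcon
      push Not at hcon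
      have : ∑ i, (b i).natAbs = 0 := Finset.sum_eq_zero fun i _ => by simp [hcon i]
      omega
    rcases hsign i with ⟨hxi, hbi⟩ | ⟨hxi, hbi⟩
    · -- step `+eᵢ`
      have hbi' : 0 < b i := lt_of_le_of_ne hbi (Ne.symm hi)
      set b' : Site d := b - Pi.single i 1 with hb'
      have hxe : x + Pi.single i 1 ∈ box d L := by
        rw [mem_box] at hx hxb ⊢
        intro j
        by_cases hj : j = i
        · subst hj
          have h1 := hx j; have h2 := hxb j
          simp only [Pi.add_apply, Pi.single_eq_same] at h2 ⊢
          omega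
        · have h1 := hx j
          simp only [Pi.add_apply, Pi.single_eq_of_ne hj, add_zero]
          exact h1
      have hstep := isingExpect_plus_spinAt_le_add_single hβ hh i hxi hx hxe
      have hsum' : ∑ j, (b' j).natAbs = n := by
        have hsplit : ∑ j, (b j).natAbs = (b i).natAbs + ∑ j ∈ Finset.univ.erase i, (b j).natAbs :=
          (Finset.add_sum_erase _ _ (Finset.mem_univ i)).symm
        have hsplit' : ∑ j, (b' j).natAbs = (b' i).natAbs + ∑ j ∈ Finset.univ.erase i, (b' j).natAbs :=
          (Finset.add_sum_erase _ _ (Finset.mem_univ i)).symm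
        have hrest : ∑ j ∈ Finset.univ.erase i, (b' j).natAbs = ∑ j ∈ Finset.univ.erase i, (b j).natAbs :=
          Finset.sum_congr rfl fun j hj => by
            rw [hb', Pi.sub_apply, Pi.single_eq_of_ne (Finset.ne_of_mem_erase hj), sub_zero]
        have hbi2 : (b' i).natAbs + 1 = (b i).natAbs := by
          rw [hb', Pi.sub_apply, Pi.single_eq_same]
          omega
        omega
      have hrec := ih (x + Pi.single i 1) b' hsum' hxe (by rwa [hb', add_add_sub_cancel])
        (fun j => by
          by_cases hj : j = i
          · subst hj
            left
            simp only [Pi.add_apply, Pi.single_eq_same, hb', Pi.sub_apply]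
            omega
          · simp only [Pi.add_apply, Pi.single_eq_of_ne hj, add_zero, hb', Pi.sub_apply, sub_zero]
            exact hsign j)
      rw [hb', add_add_sub_cancel] at hrec
      exact hstep.trans hrec
    · -- step `-eᵢ`
      have hbi' : b i < 0 := lt_of_le_of_ne hbi hi
      set b' : Site d := b + Pi.single i 1 with hb'
      have hxe : x - Pi.single i 1 ∈ box d L := by
        rw [mem_box] at hx hxb ⊢
        intro j
        by_cases hj : j = i
        · subst hj
          have h1 := hx j; have h2 := hxb j
          simp only [Pi.add_apply, Pi.sub_apply, Pi.single_eq_same] at h2 ⊢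
          omega
        · have h1 := hx j
          simp only [Pi.sub_apply, Pi.single_eq_of_ne hj, sub_zero]
          exact h1
      have hstep := isingExpect_plus_spinAt_le_sub_single hβ hh i hxi hx hxe
      have hsum' : ∑ j, (b' j).natAbs = n := by
        have hsplit : ∑ j, (b j).natAbs = (b i).natAbs + ∑ j ∈ Finset.univ.erase i, (b j).natAbs :=
          (Finset.add_sum_erase _ _ (Finset.mem_univ i)).symm
        have hsplit' : ∑ j, (b' j).natAbs = (b' i).natAbs + ∑ j ∈ Finset.univ.erase i, (b' j).natAbs :=
          (Finset.add_sum_erase _ _ (Finset.mem_univ i)).symm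
        have hrest : ∑ j ∈ Finset.univ.erase i, (b' j).natAbs = ∑ j ∈ Finset.univ.erase i, (b j).natAbs :=
          Finset.sum_congr rfl fun j hj => by
            rw [hb', Pi.add_apply, Pi.single_eq_of_ne (Finset.ne_of_mem_erase hj), add_zero]
        have hbi2 : (b' i).natAbs + 1 = (b i).natAbs := by
          rw [hb', Pi.add_apply, Pi.single_eq_same]
          omega
        omega
      have hxb' : x - Pi.single i 1 + b' ∈ box d L := by
        rwa [hb', sub_add_add_cancel]
      have hrec := ih (x - Pi.single i 1) b' hsum' hxe hxb'
        (fun j => by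
          by_cases hj : j = i
          · subst hj
            right
            simp only [Pi.sub_apply, Pi.single_eq_same, hb', Pi.add_apply]
            omega
          · simp only [Pi.sub_apply, Pi.single_eq_of_ne hj, sub_zero, hb', Pi.add_apply, add_zero]
            exact hsign j)
      rw [hb', sub_add_add_cancel] at hrec
      exact hstep.trans hrec

end ZdBoxes

/-! ### B. Lebowitz' inequality with fields: the kurtosis of a nonnegative linear spin observable

Under the `+` (or free) finite-volume measure with `β, h ≥ 0` the couplings are nonnegative and
supported on at most two sites, so Lebowitz' bound on the covariance of pair observables
(`gksExpect_cov_spinPair_le`, valid WITH fields) gives, for `X = ∑ cₓ σₓ` with `cₓ ≥ 0`,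
`⟨X⁴⟩ ≤ 5 ⟨X²⟩²` for the UNCENTRED moments — the anti-concentration input replacing the
evenness used in print. -/

section Kurtosis

variable {V : Type*} [DecidableEq V] (G : SimpleGraph V) [G.LocallyFinite]

/-- The finite-volume Gibbs expectation of an observable depending only on the spins in `Λ` is
its expectation in the spin system `ν_{Λ;K}` of Friedli–Velenik §3.8.1 (bridge to
`GKSInequalities`; Friedli–Velenik 2017, §3.8.1, p. 141). [cite: FriedliVelenik2017, §3.8.1, p. 141] -/
theorem isingExpect_eq_gksExpect_of_glue (Λ : Finset V) (β h : ℝ) (bc : BoundaryCondition V)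
    {f : SpinConfig V → ℝ} (hf : Measurable f) {Φ : SpinConfig ↥Λ → ℝ}
    (hΦ : ∀ τ : SpinConfig ↥Λ, f (glue Λ τ bc) = Φ τ) :
    isingExpect G Λ β h bc f =
      gksExpect (isingIdx G Λ) (gksCoupling G Λ β h bc) (isingSupp Λ) Φ := by
  rw [isingExpect_eq_sum_div G Λ h bc β hf, gksExpect, gksSum, gksSum, isingPartitionFunction]
  congr 1
  · refine Finset.sum_congr rfl fun τ _ => ?_
    rw [isingWeight_eq_gksWeight, hΦ τ, mul_comm]
  · refine Finset.sum_congr rfl fun τ _ => ?_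
    rw [isingWeight_eq_gksWeight, one_mul]

variable {Λ' : Type*} [Fintype Λ'] [DecidableEq Λ'] {ι : Type*}

/-- Monotonicity of `⟨·⟩_{Λ;K}` (a positive normalised functional). [folklore] -/
theorem gksExpect_mono (s : Finset ι) (K : ι → ℝ) (C : ι → Finset Λ') {F F' : SpinConfig Λ' → ℝ}
    (hFF' : ∀ ω, F ω ≤ F' ω) : gksExpect s K C F ≤ gksExpect s K C F' := by
  simp only [gksExpect]
  refine div_le_div_of_nonneg_right ?_ (gksSum_one_pos s K C).le
  exact Finset.sum_le_sum fun ω _ => mul_le_mul_of_nonneg_right (hFF' ω) (gksWeight_pos s K C ω).le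

/-- **Lebowitz' bound with fields, four-point form**: for couplings `Kᵢ ≥ 0` supported on at most
two sites, `⟨σ_aσ_zσ_xσ_y⟩ ≤ ⟨σ_aσ_z⟩⟨σ_xσ_y⟩ + 2⟨σ_aσ_x⟩⟨σ_yσ_z⟩ + 2⟨σ_aσ_y⟩⟨σ_xσ_z⟩`
(Glimm–Jaffe 1987, Cor. 4.3.2 / Lebowitz 1974, as `gksExpect_cov_spinPair_le`). [cite: GlimmJaffe1987, Cor. 4.3.2 and Cor. 4.3.3] -/
theorem gksExpect_four_le [DecidableEq ι] (s : Finset ι) {K : ι → ℝ} {C : ι → Finset Λ'}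
    (hK : ∀ i ∈ s, 0 ≤ K i) (hC : ∀ i ∈ s, (C i).card ≤ 2) (a z x y : Λ') :
    gksExpect s K C (fun ω => spinPair a z ω * spinPair x y ω) ≤
      gksExpect s K C (spinPair a z) * gksExpect s K C (spinPair x y) +
        2 * (gksExpect s K C (spinPair a x) * gksExpect s K C (spinPair y z) +
          gksExpect s K C (spinPair a y) * gksExpect s K C (spinPair x z)) := by
  have h := gksExpect_cov_spinPair_le s K C hK hC a z x y
  linarith

omit [DecidableEq Λ'] in
/-- `(∑ cᵤ σᵤ)² = ∑ᵤ ∑ᵥ cᵤ c_v σᵤσ_v`. [folklore] -/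
theorem sq_sum_mul_spinAt_eq (c : Λ' → ℝ) (ω : SpinConfig Λ') :
    (∑ u, c u * spinAt u ω) ^ 2 = ∑ u, ∑ v, c u * c v * spinPair u v ω := by
  rw [sq, Finset.sum_mul_sum]
  refine Finset.sum_congr rfl fun u _ => Finset.sum_congr rfl fun v _ => ?_
  rw [spinPair]; ring

omit [DecidableEq Λ'] in
/-- `(∑ cᵤ σᵤ)⁴ = ∑_a ∑_z ∑_x ∑_y c_a c_z c_x c_y (σ_aσ_z)(σ_xσ_y)`. [folklore] -/
theorem pow_four_sum_mul_spinAt_eq (c : Λ' → ℝ) (ω : SpinConfig Λ') :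
    (∑ u, c u * spinAt u ω) ^ 4 =
      ∑ a, ∑ z, ∑ x, ∑ y, c a * c z * c x * c y * (spinPair a z ω * spinPair x y ω) := by
  have h4 : (∑ u, c u * spinAt u ω) ^ 4 = (∑ u, c u * spinAt u ω) ^ 2 * (∑ u, c u * spinAt u ω) ^ 2 := by
    ring
  rw [h4, sq_sum_mul_spinAt_eq]
  rw [Finset.sum_mul]
  refine Finset.sum_congr rfl fun a _ => ?_
  rw [Finset.sum_mul]
  refine Finset.sum_congr rfl fun z _ => ?_
  rw [Finset.mul_sum]
  refine Finset.sum_congr rfl fun x _ => ?_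
  rw [Finset.mul_sum]
  refine Finset.sum_congr rfl fun y _ => ?_
  ring

/-- **Kurtosis of a nonnegative linear spin observable in a ferromagnetic pair system with
nonnegative fields**: for `Kᵢ ≥ 0` on supports of at most two sites and `cᵤ ≥ 0`,
`⟨(∑ cᵤσᵤ)⁴⟩ ≤ 5 ⟨(∑ cᵤσᵤ)²⟩²` (uncentred moments; sum Lebowitz' four-point bound
`gksExpect_four_le` against `c_a c_z c_x c_y ≥ 0`). [cite: GlimmJaffe1987, Cor. 4.3.2 and Cor. 4.3.3] -/
theorem gksExpect_pow_four_le [DecidableEq ι] (s : Finset ι) {K : ι → ℝ} {C : ι → Finset Λ'}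
    (hK : ∀ i ∈ s, 0 ≤ K i) (hC : ∀ i ∈ s, (C i).card ≤ 2) {c : Λ' → ℝ} (hc : ∀ u, 0 ≤ c u) :
    gksExpect s K C (fun ω => (∑ u, c u * spinAt u ω) ^ 4) ≤
      5 * (gksExpect s K C (fun ω => (∑ u, c u * spinAt u ω) ^ 2)) ^ 2 := by
  set S : Λ' → Λ' → ℝ := fun u v => gksExpect s K C (spinPair u v) with hS
  have hSsymm : ∀ u v, S u v = S v u := fun u v => by simp only [hS, spinPair_comm u v]
  set Q : ℝ := ∑ u, ∑ v, c u * c v * S u v with hQ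
  -- second moment
  have h2 : gksExpect s K C (fun ω => (∑ u, c u * spinAt u ω) ^ 2) = Q := by
    simp_rw [sq_sum_mul_spinAt_eq]
    rw [gksExpect_finset_sum]
    refine Finset.sum_congr rfl fun u _ => ?_
    rw [gksExpect_finset_sum]
    refine Finset.sum_congr rfl fun v _ => ?_
    rw [gksExpect_const_mul]
  -- fourth moment, expanded and bounded termwise
  have h4 : gksExpect s K C (fun ω => (∑ u, c u * spinAt u ω) ^ 4) =
      ∑ a, ∑ z, ∑ x, ∑ y, c a * c z * c x * c y *
        gksExpect s K C (fun ω => spinPair a z ω * spinPair x y ω) := by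
    simp_rw [pow_four_sum_mul_spinAt_eq]
    rw [gksExpect_finset_sum]
    refine Finset.sum_congr rfl fun a _ => ?_
    rw [gksExpect_finset_sum]
    refine Finset.sum_congr rfl fun z _ => ?_
    rw [gksExpect_finset_sum]
    refine Finset.sum_congr rfl fun x _ => ?_
    rw [gksExpect_finset_sum]
    refine Finset.sum_congr rfl fun y _ => ?_
    rw [gksExpect_const_mul]
  have hbound : gksExpect s K C (fun ω => (∑ u, c u * spinAt u ω) ^ 4) ≤
      ∑ a, ∑ z, ∑ x, ∑ y, c a * c z * c x * c y *
        (S a z * S x y + 2 * (S a x * S y z + S a y * S x z)) := by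
    rw [h4]
    refine Finset.sum_le_sum fun a _ => Finset.sum_le_sum fun z _ =>
      Finset.sum_le_sum fun x _ => Finset.sum_le_sum fun y _ => ?_
    exact mul_le_mul_of_nonneg_left (gksExpect_four_le s hK hC a z x y)
      (mul_nonneg (mul_nonneg (mul_nonneg (hc a) (hc z)) (hc x)) (hc y))
  -- the three pairings each sum to `Q²`
  have hP1 : ∑ a, ∑ z, ∑ x, ∑ y, c a * c z * c x * c y * (S a z * S x y) = Q * Q := by
    rw [hQ, Finset.sum_mul]
    refine Finset.sum_congr rfl fun a _ => ?_
    rw [Finset.sum_mul]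
    refine Finset.sum_congr rfl fun z _ => ?_
    rw [Finset.mul_sum]
    refine Finset.sum_congr rfl fun x _ => ?_
    rw [Finset.mul_sum]
    refine Finset.sum_congr rfl fun y _ => ?_
    ring
  have hP2 : ∑ a, ∑ z, ∑ x, ∑ y, c a * c z * c x * c y * (S a x * S y z) = Q * Q := by
    have hswap : ∑ a, ∑ z, ∑ x, ∑ y, c a * c z * c x * c y * (S a x * S y z) =
        ∑ a, ∑ x, ∑ z, ∑ y, c a * c z * c x * c y * (S a x * S y z) :=
      Finset.sum_congr rfl fun a _ => Finset.sum_comm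
    rw [hswap, hQ, Finset.sum_mul]
    refine Finset.sum_congr rfl fun a _ => ?_
    rw [Finset.sum_mul]
    refine Finset.sum_congr rfl fun x _ => ?_
    rw [Finset.mul_sum]
    refine Finset.sum_congr rfl fun z _ => ?_
    rw [Finset.mul_sum]
    refine Finset.sum_congr rfl fun y _ => ?_
    rw [hSsymm y z]
    ring
  have hP3 : ∑ a, ∑ z, ∑ x, ∑ y, c a * c z * c x * c y * (S a y * S x z) = Q * Q := by
    have hswap : ∀ a, ∑ z, ∑ x, ∑ y, c a * c z * c x * c y * (S a y * S x z) =
        ∑ y, ∑ x, ∑ z, c a * c z * c x * c y * (S a y * S x z) := fun a =>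
      calc ∑ z, ∑ x, ∑ y, c a * c z * c x * c y * (S a y * S x z)
          = ∑ x, ∑ z, ∑ y, c a * c z * c x * c y * (S a y * S x z) := Finset.sum_comm
        _ = ∑ x, ∑ y, ∑ z, c a * c z * c x * c y * (S a y * S x z) :=
            Finset.sum_congr rfl fun x _ => Finset.sum_comm
        _ = ∑ y, ∑ x, ∑ z, c a * c z * c x * c y * (S a y * S x z) := Finset.sum_comm
    rw [Finset.sum_congr rfl fun a _ => hswap a, hQ, Finset.sum_mul]
    refine Finset.sum_congr rfl fun a _ => ?_
    rw [Finset.sum_mul]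
    refine Finset.sum_congr rfl fun y _ => ?_
    rw [Finset.mul_sum]
    refine Finset.sum_congr rfl fun x _ => ?_
    rw [Finset.mul_sum]
    refine Finset.sum_congr rfl fun z _ => ?_
    ring
  have hsplit : ∑ a, ∑ z, ∑ x, ∑ y, c a * c z * c x * c y *
      (S a z * S x y + 2 * (S a x * S y z + S a y * S x z)) =
      (∑ a, ∑ z, ∑ x, ∑ y, c a * c z * c x * c y * (S a z * S x y)) +
        2 * (∑ a, ∑ z, ∑ x, ∑ y, c a * c z * c x * c y * (S a x * S y z)) +
        2 * (∑ a, ∑ z, ∑ x, ∑ y, c a * c z * c x * c y * (S a y * S x z)) := by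
    simp only [Finset.mul_sum, ← Finset.sum_add_distrib]
    refine Finset.sum_congr rfl fun a _ => Finset.sum_congr rfl fun z _ =>
      Finset.sum_congr rfl fun x _ => Finset.sum_congr rfl fun y _ => ?_
    ring
  rw [h2]
  calc gksExpect s K C (fun ω => (∑ u, c u * spinAt u ω) ^ 4)
      ≤ _ := hbound
    _ = Q * Q + 2 * (Q * Q) + 2 * (Q * Q) := by rw [hsplit, hP1, hP2, hP3]
    _ = 5 * Q ^ 2 := by ring

/-- **Kurtosis bound for the `+` (or free) finite-volume Ising measure with `β, h ≥ 0`**: for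
coefficients `cₓ ≥ 0`, the linear spin observable `X = ∑_{x ∈ Λ} cₓ σₓ` satisfies
`⟨X⁴⟩^{bc}_{Λ;β,h} ≤ 5 (⟨X²⟩^{bc}_{Λ;β,h})²` (Lebowitz 1974 / Glimm–Jaffe 1987, Cor. 4.3.2, in the
pair system `ν_{Λ;K}` of Friedli–Velenik 2017, §3.8.1). [cite: GlimmJaffe1987, Cor. 4.3.2 and Cor. 4.3.3] [cite: FriedliVelenik2017, §3.8.1, p. 141] -/
theorem isingExpect_pow_four_le {β h : ℝ} (hβ : 0 ≤ β) (hh : 0 ≤ h) (Λ : Finset V)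
    {bc : BoundaryCondition V} (hbc : bc = .free ∨ bc = .plus) {c : V → ℝ} (hc : ∀ x, 0 ≤ c x) :
    isingExpect G Λ β h bc (fun σ => (∑ x ∈ Λ, c x * spinAt x σ) ^ 4) ≤
      5 * (isingExpect G Λ β h bc (fun σ => (∑ x ∈ Λ, c x * spinAt x σ) ^ 2)) ^ 2 := by
  classical
  have hglue : ∀ τ : SpinConfig ↥Λ, ∑ x ∈ Λ, c x * spinAt x (glue Λ τ bc) =
      ∑ u : ↥Λ, c u * spinAt u τ := by
    intro τ
    rw [← Finset.sum_coe_sort Λ]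
    exact Finset.sum_congr rfl fun u _ => by rw [spinAt_glue_coe τ bc u]
  have hm : Measurable fun σ : SpinConfig V => ∑ x ∈ Λ, c x * spinAt x σ :=
    Finset.measurable_sum _ fun x _ => (measurable_spinAt x).const_mul _
  rw [isingExpect_eq_gksExpect_of_glue G Λ β h bc (hm.pow_const 4)
      (Φ := fun τ => (∑ u : ↥Λ, c u * spinAt u τ) ^ 4) (fun τ => by simp only [hglue τ]),
    isingExpect_eq_gksExpect_of_glue G Λ β h bc (hm.pow_const 2)
      (Φ := fun τ => (∑ u : ↥Λ, c u * spinAt u τ) ^ 2) (fun τ => by simp only [hglue τ])]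
  exact gksExpect_pow_four_le (isingIdx G Λ) (gksCoupling_nonneg G hβ hh hbc)
    (fun i _ => card_isingSupp_le_two Λ i) (fun u => hc u)

end Kurtosis

/-! ### C. Tight families with bounded kurtosis: a quantitative variance bound

Quantitative form of `eventually_variance_le_of_tendsto` (`ContinuumLimitsTrivialityAssemblyProofs`):
the eventual bound on the second moments is explicit in the second moment of the limit law
(Chebyshev for the limit, portmanteau, Paley–Zygmund), as needed to compare test functions of
different scales. -/

section QuantTight

/-- **Tight families with bounded kurtosis have explicitly bounded variance.** Let probability
laws `P_i → P₀` weakly on `ℝ` along a filter, with `∫ x⁴ dP_i ≤ B (∫ x² dP_i)²` eventually, and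
let `∫ x² dP₀ = s₀ < ∞`. Then eventually `∫ x² dP_i ≤ 16 max(B,1) (s₀ + 1)`: with
`p₀ = 1/(4 max(B,1))` and `R² = 2(s₀+1)/p₀`, Chebyshev gives `P₀(|x| ≥ R) ≤ s₀/R² < p₀`, the
portmanteau theorem transfers `P_i(|x| ≥ R) < p₀` eventually, and if `v_i = ∫ x² dP_i > 2R²` the
Paley–Zygmund inequality `P_i(x² ≥ v_i/2) ≥ 1/(4 max(B,1))` is contradicted. [folklore] -/
theorem eventually_integral_sq_le_of_tendsto_of_kurtosis {ι : Type*} {l : Filter ι}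
    {P : ι → ProbabilityMeasure ℝ} {P₀ : ProbabilityMeasure ℝ} (hP : Tendsto P l (𝓝 P₀))
    {B : ℝ} (h4 : ∀ᶠ i in l, Integrable (fun x : ℝ => x ^ 4) (P i : Measure ℝ) ∧
      ∫ x, x ^ 4 ∂(P i : Measure ℝ) ≤ B * (∫ x, x ^ 2 ∂(P i : Measure ℝ)) ^ 2)
    (h2 : Integrable (fun x : ℝ => x ^ 2) (P₀ : Measure ℝ)) :
    ∀ᶠ i in l, ∫ x, x ^ 2 ∂(P i : Measure ℝ) ≤
      16 * max B 1 * (∫ x, x ^ 2 ∂(P₀ : Measure ℝ) + 1) := by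
  set B' : ℝ := max B 1 with hB'_def
  have hB'pos : 0 < B' := lt_of_lt_of_le one_pos (le_max_right _ _)
  have hBB' : B ≤ B' := le_max_left _ _
  set p₀ : ℝ := 1 / (4 * B') with hp₀_def
  have hp₀ : 0 < p₀ := by positivity
  set s₀ : ℝ := ∫ x, x ^ 2 ∂(P₀ : Measure ℝ) with hs₀_def
  have hs₀ : 0 ≤ s₀ := integral_nonneg fun x => sq_nonneg x
  -- the radius `R` with `R² = 2 (s₀ + 1) / p₀ = 8 B' (s₀ + 1)`
  set R : ℝ := Real.sqrt (2 * (s₀ + 1) / p₀) with hR_def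
  have hR2 : R ^ 2 = 2 * (s₀ + 1) / p₀ := Real.sq_sqrt (by positivity)
  have hRpos : 0 < R := Real.sqrt_pos.2 (by positivity)
  have hR2' : 2 * R ^ 2 = 16 * B' * (s₀ + 1) := by
    rw [hR2, hp₀_def]
    field_simp
    ring
  set F : Set ℝ := {x : ℝ | R ≤ |x|} with hF_def
  have hFclosed : IsClosed F := isClosed_le continuous_const continuous_abs
  -- Chebyshev for the limit law
  have hP₀F : (P₀ : Measure ℝ).real F < p₀ := by
    have hsub : F ⊆ {x : ℝ | R ^ 2 ≤ x ^ 2} := fun x (hx : R ≤ |x|) => by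
      show R ^ 2 ≤ x ^ 2
      rw [← sq_abs x]
      exact pow_le_pow_left₀ hRpos.le hx 2
    have hcheb := mul_meas_ge_le_integral_of_nonneg (μ := (P₀ : Measure ℝ))
      (Eventually.of_forall fun x : ℝ => sq_nonneg x) h2 (R ^ 2)
    have h1 : (P₀ : Measure ℝ).real F ≤ (P₀ : Measure ℝ).real {x : ℝ | R ^ 2 ≤ x ^ 2} :=
      measureReal_mono hsub
    have hR2pos : 0 < R ^ 2 := by positivity
    have h3 : (P₀ : Measure ℝ).real {x : ℝ | R ^ 2 ≤ x ^ 2} ≤ s₀ / R ^ 2 := by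
      rw [le_div_iff₀ hR2pos, mul_comm]
      exact hcheb
    have h4' : s₀ / R ^ 2 < p₀ := by
      rw [hR2, div_div_eq_mul_div, div_lt_iff₀ (by positivity)]
      nlinarith
    linarith
  have hP₀F' : (P₀ : Measure ℝ) F < ENNReal.ofReal p₀ := by
    rw [← ofReal_measureReal (measure_ne_top _ _)]
    exact (ENNReal.ofReal_lt_ofReal_iff hp₀).2 hP₀F
  -- portmanteau: eventually `P_i(F) < p₀`
  have hev : ∀ᶠ i in l, (P i : Measure ℝ) F < ENNReal.ofReal p₀ :=
    eventually_lt_of_limsup_lt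
      ((ProbabilityMeasure.limsup_measure_closed_le_of_tendsto hP hFclosed).trans_lt hP₀F')
  filter_upwards [h4, hev] with i h4i hlti
  rw [← hR2']
  by_contra hcon
  push Not at hcon
  set v : ℝ := ∫ x, x ^ 2 ∂(P i : Measure ℝ) with hv_def
  have hvpos : 0 < v := lt_trans (by positivity) hcon
  obtain ⟨hint4, hm⟩ := h4i
  have hPZ := sq_variance_le_fourth_mul_measure (P i : Measure ℝ) hint4 hvpos
  rw [← hv_def] at hPZ
  set A : Set ℝ := {x : ℝ | v / 2 ≤ x ^ 2} with hA_def
  have hAF : A ⊆ F := by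
    intro x hx
    have hx2 : R ^ 2 < x ^ 2 := by
      have hx' : v / 2 ≤ x ^ 2 := hx
      linarith
    have : R < |x| := lt_of_pow_lt_pow_left₀ 2 (abs_nonneg x) (by rwa [sq_abs])
    exact this.le
  have hPA : (P i : Measure ℝ).real A < p₀ :=
    ENNReal.toReal_lt_of_lt_ofReal ((measure_mono hAF).trans_lt hlti)
  have h1 : v ^ 2 ≤ 4 * (B' * v ^ 2) * (P i : Measure ℝ).real A := by
    refine hPZ.trans ?_
    gcongr
    exact hm.trans (mul_le_mul_of_nonneg_right hBB' (sq_nonneg _))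
  have h2' : 4 * B' * (P i : Measure ℝ).real A < 1 := by
    rw [hp₀_def, lt_div_iff₀ (by positivity)] at hPA
    linarith
  have hv2 : 0 < v ^ 2 := by positivity
  nlinarith

end QuantTight

/-! ### D. Second moments of the plus-box field from convergence in law

For a nonnegative test function `g`, the marginal laws of `ω(g)` under the plus-box laws
`isingFieldLaw` converge weakly (Lévy); their kurtosis is at most `5` (section B); so by section C
their second moments are eventually at most `80 (∫ ω(g)² dμ + 1)`. In particular the renormalised
plus-boundary magnetisation functional `𝔪_δ(g) = |ρ(δ)| δᵈ ∑ g(δx) ⟨σₓ⟩⁺` is eventually bounded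
by `√(80 (∫ ω(g)² dμ + 1))`, WITHOUT any evenness of the approximating laws. -/

section SecondMoments

variable {d : ℕ}

/-- The linear spin observable smeared against `g` is bounded by `∑ |coefficients|`. [folklore] -/
theorem abs_sum_coeff_mul_spinAt_le (Λ : Finset (Site d)) (c : Site d → ℝ) (σ : SpinConfig (Site d)) :
    |∑ x ∈ Λ, c x * spinAt x σ| ≤ ∑ x ∈ Λ, |c x| := by
  refine (Finset.abs_sum_le_sum_abs _ _).trans (Finset.sum_le_sum fun x _ => ?_)
  rw [abs_mul, abs_spinAt, mul_one]

/-- Bounded measurable observables are integrable against the finite-volume Gibbs measure. [folklore] -/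
theorem integrable_isingMeasure_of_bounded {V : Type*} [DecidableEq V] (G : SimpleGraph V)
    [G.LocallyFinite] (Λ : Finset V) (β h : ℝ) (bc : BoundaryCondition V)
    {f : SpinConfig V → ℝ} (hf : Measurable f) {M : ℝ} (hM : ∀ σ, |f σ| ≤ M) :
    Integrable f (isingMeasure G Λ β h bc) :=
  Integrable.mono' (integrable_const M) hf.aestronglyMeasurable
    (Eventually.of_forall fun σ => by rw [Real.norm_eq_abs]; exact hM σ)

/-- **Moments of the marginal `ω(g)` of the plus-box field law are plus-box expectations of powers
of the linear spin observable** `X_g = ∑_{x ∈ box} (ρ δᵈ g(δx)) σₓ`. [folklore] -/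
theorem integral_pow_eval_isingFieldLaw (β : ℝ) (L : ℝ → ℕ) (δ : ℝ) (ρ : ℝ → ℝ)
    (g : 𝓢(EuclideanSpace ℝ (Fin d), ℝ)) (k : ℕ) :
    ∫ ω, (ω g) ^ k ∂(isingFieldLaw d β L δ ρ) =
      isingExpect (zdGraph d) (box d (L δ)) β 0 .plus
        (fun σ => (∑ x ∈ box d (L δ), (ρ δ * δ ^ d * g (δ • siteToE x)) * spinAt x σ) ^ k) := by
  rw [isingFieldLaw_eq_map,
    integral_map (measurable_spinField (box d (L δ)) δ (ρ δ)).aemeasurable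
      (((measurable_eval g).pow_const k).aestronglyMeasurable)]
  unfold isingExpect
  refine integral_congr_ae (Eventually.of_forall fun σ => ?_)
  simp only [spinField_apply_eq_sum_mul_spinAt]

/-- Pulling the sign of `ρ` out: even powers of `X_g` only see `|ρ|`. [folklore] -/
theorem pow_sum_coeff_eq_pow_sum_abs_coeff (Λ : Finset (Site d)) (ρ δ : ℝ)
    (g : EuclideanSpace ℝ (Fin d) → ℝ) (σ : SpinConfig (Site d)) {k : ℕ} (hk : Even k) :
    (∑ x ∈ Λ, (ρ * δ ^ d * g (δ • siteToE x)) * spinAt x σ) ^ k =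
      (∑ x ∈ Λ, (|ρ| * δ ^ d * g (δ • siteToE x)) * spinAt x σ) ^ k := by
  have h1 : ∑ x ∈ Λ, (ρ * δ ^ d * g (δ • siteToE x)) * spinAt x σ =
      ρ * ∑ x ∈ Λ, (δ ^ d * g (δ • siteToE x)) * spinAt x σ := by
    rw [Finset.mul_sum]; exact Finset.sum_congr rfl fun x _ => by ring
  have h2 : ∑ x ∈ Λ, (|ρ| * δ ^ d * g (δ • siteToE x)) * spinAt x σ =
      |ρ| * ∑ x ∈ Λ, (δ ^ d * g (δ • siteToE x)) * spinAt x σ := by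
    rw [Finset.mul_sum]; exact Finset.sum_congr rfl fun x _ => by ring
  rw [h1, h2, mul_pow, mul_pow, hk.pow_abs]

/-- **Eventual second-moment bound for the plus-box field, for nonnegative test functions.**
Under convergence in law of the plus-box laws `isingFieldLaw d (β δ) L δ ρ → μ` (`δ → 0⁺`,
`β(δ) ≥ 0`) to a law with square-integrable evaluations, for every test function `g ≥ 0`:
eventually `⟨X_g²⟩⁺_{box;β(δ),0} ≤ 80 (∫ ω(g)² dμ + 1)` with
`X_g = ∑_{x ∈ box d (L δ)} |ρ(δ)| δᵈ g(δx) σₓ` (Lévy on the ray `t • g`; kurtosis `≤ 5` by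
Lebowitz' inequality with fields, `isingExpect_pow_four_le`; quantitative tightness,
`eventually_integral_sq_le_of_tendsto_of_kurtosis`). [folklore] -/
theorem eventually_isingExpect_sq_le_of_tendstoInLaw {β ρ : ℝ → ℝ} {L : ℝ → ℕ}
    {μ : Measure (FieldConfig (EuclideanSpace ℝ (Fin d)))}
    (hβ : ∀ δ, 0 ≤ β δ)
    (hlim : TendstoInLaw (fun δ => isingFieldLaw d (β δ) L δ ρ) (𝓝[>] 0) μ)
    (h2μ : ∀ f : 𝓢(EuclideanSpace ℝ (Fin d), ℝ),
      MemLp (fun ω : FieldConfig (EuclideanSpace ℝ (Fin d)) => ω f) 2 μ)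
    {g : 𝓢(EuclideanSpace ℝ (Fin d), ℝ)} (hg : ∀ y, 0 ≤ g y) :
    ∀ᶠ δ in 𝓝[>] (0 : ℝ),
      isingExpect (zdGraph d) (box d (L δ)) (β δ) 0 .plus
        (fun σ => (∑ x ∈ box d (L δ), (|ρ δ| * δ ^ d * g (δ • siteToE x)) * spinAt x σ) ^ 2) ≤
      80 * (∫ ω, (ω g) ^ 2 ∂μ + 1) := by
  have hprob : ∀ᶠ δ in 𝓝[>] (0 : ℝ), IsProbabilityMeasure (isingFieldLaw d (β δ) L δ ρ) :=
    Eventually.of_forall fun δ => inferInstance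
  haveI : IsProbabilityMeasure μ := isProbabilityMeasure_of_tendstoInLaw hprob hlim
  -- the marginal laws on the ray of `g`
  let P : ℝ → ProbabilityMeasure ℝ := fun δ =>
    ⟨(isingFieldLaw d (β δ) L δ ρ).map (fun ω : FieldConfig (EuclideanSpace ℝ (Fin d)) => ω g),
      Measure.isProbabilityMeasure_map (measurable_eval g).aemeasurable⟩
  let P₀ : ProbabilityMeasure ℝ := ⟨μ.map (fun ω : FieldConfig (EuclideanSpace ℝ (Fin d)) => ω g),
    Measure.isProbabilityMeasure_map (measurable_eval g).aemeasurable⟩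
  have hP : ∀ᶠ δ in 𝓝[>] (0 : ℝ), (P δ : Measure ℝ) =
      (isingFieldLaw d (β δ) L δ ρ).map (fun ω : FieldConfig (EuclideanSpace ℝ (Fin d)) => ω g) :=
    Eventually.of_forall fun δ => rfl
  have hP₀ : (P₀ : Measure ℝ) = μ.map (fun ω : FieldConfig (EuclideanSpace ℝ (Fin d)) => ω g) := rfl
  have hconv := tendsto_marginal_of_tendstoInLaw hlim g hP hP₀
  -- moments of the marginals are plus-box expectations
  have hmom : ∀ δ : ℝ, ∀ k : ℕ, ∫ x, x ^ k ∂(P δ : Measure ℝ) =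
      isingExpect (zdGraph d) (box d (L δ)) (β δ) 0 .plus
        (fun σ => (∑ x ∈ box d (L δ), (ρ δ * δ ^ d * g (δ • siteToE x)) * spinAt x σ) ^ k) := by
    intro δ k
    change ∫ x, x ^ k ∂((isingFieldLaw d (β δ) L δ ρ).map
      (fun ω : FieldConfig (EuclideanSpace ℝ (Fin d)) => ω g)) = _
    rw [integral_map_eval _ g (by fun_prop)]
    exact integral_pow_eval_isingFieldLaw (β δ) L δ ρ g k
  have hδpos : ∀ᶠ δ in 𝓝[>] (0 : ℝ), 0 < δ := eventually_mem_nhdsWithin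
  -- kurtosis `≤ 5`
  have h4 : ∀ᶠ δ in 𝓝[>] (0 : ℝ), Integrable (fun x : ℝ => x ^ 4) (P δ : Measure ℝ) ∧
      ∫ x, x ^ 4 ∂(P δ : Measure ℝ) ≤ 5 * (∫ x, x ^ 2 ∂(P δ : Measure ℝ)) ^ 2 := by
    filter_upwards [hδpos] with δ hδ
    refine ⟨?_, ?_⟩
    · change Integrable (fun x : ℝ => x ^ 4) ((isingFieldLaw d (β δ) L δ ρ).map
        (fun ω : FieldConfig (EuclideanSpace ℝ (Fin d)) => ω g))
      rw [integrable_map_eval_iff _ g (by fun_prop), isingFieldLaw_eq_map,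
        integrable_map_measure (((measurable_eval g).pow_const 4).aestronglyMeasurable)
          (measurable_spinField (box d (L δ)) δ (ρ δ)).aemeasurable]
      set c : Site d → ℝ := fun x => ρ δ * δ ^ d * g (δ • siteToE x) with hc
      refine integrable_isingMeasure_of_bounded (zdGraph d) _ _ _ _
        (((measurable_eval g).pow_const 4).comp (measurable_spinField (box d (L δ)) δ (ρ δ)))
        (M := (∑ x ∈ box d (L δ), |c x|) ^ 4) fun σ => ?_
      simp only [Function.comp_apply, spinField_apply_eq_sum_mul_spinAt]
      rw [abs_pow]
      exact pow_le_pow_left₀ (abs_nonneg _) (abs_sum_coeff_mul_spinAt_le _ c σ) 4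
    · rw [hmom δ 4, hmom δ 2]
      have heq4 : (fun σ : SpinConfig (Site d) =>
          (∑ x ∈ box d (L δ), (ρ δ * δ ^ d * g (δ • siteToE x)) * spinAt x σ) ^ 4) =
          fun σ => (∑ x ∈ box d (L δ), (|ρ δ| * δ ^ d * g (δ • siteToE x)) * spinAt x σ) ^ 4 :=
        funext fun σ => pow_sum_coeff_eq_pow_sum_abs_coeff _ (ρ δ) δ g σ (by decide)
      have heq2 : (fun σ : SpinConfig (Site d) =>
          (∑ x ∈ box d (L δ), (ρ δ * δ ^ d * g (δ • siteToE x)) * spinAt x σ) ^ 2) =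
          fun σ => (∑ x ∈ box d (L δ), (|ρ δ| * δ ^ d * g (δ • siteToE x)) * spinAt x σ) ^ 2 :=
        funext fun σ => pow_sum_coeff_eq_pow_sum_abs_coeff _ (ρ δ) δ g σ (by decide)
      rw [heq4, heq2]
      exact isingExpect_pow_four_le (zdGraph d) (hβ δ) le_rfl (box d (L δ)) (Or.inr rfl)
        (c := fun x => |ρ δ| * δ ^ d * g (δ • siteToE x))
        (fun x => mul_nonneg (mul_nonneg (abs_nonneg _) (pow_nonneg hδ.le d)) (hg _))
  -- the limit has a finite second moment
  have h2 : Integrable (fun x : ℝ => x ^ 2) (P₀ : Measure ℝ) := by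
    change Integrable (fun x : ℝ => x ^ 2) (μ.map (fun ω : FieldConfig (EuclideanSpace ℝ (Fin d)) => ω g))
    rw [integrable_map_eval_iff μ g (by fun_prop)]
    exact (h2μ g).integrable_sq
  have hkey := eventually_integral_sq_le_of_tendsto_of_kurtosis hconv h4 h2
  have hs₀ : ∫ x, x ^ 2 ∂(P₀ : Measure ℝ) = ∫ ω, (ω g) ^ 2 ∂μ := by
    change ∫ x, x ^ 2 ∂(μ.map (fun ω : FieldConfig (EuclideanSpace ℝ (Fin d)) => ω g)) = _
    exact integral_map_eval μ g (by fun_prop)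
  filter_upwards [hkey] with δ hδk
  rw [hmom δ 2, hs₀, show max (5 : ℝ) 1 = 5 by norm_num] at hδk
  have heq2 : (fun σ : SpinConfig (Site d) =>
      (∑ x ∈ box d (L δ), (ρ δ * δ ^ d * g (δ • siteToE x)) * spinAt x σ) ^ 2) =
      fun σ => (∑ x ∈ box d (L δ), (|ρ δ| * δ ^ d * g (δ • siteToE x)) * spinAt x σ) ^ 2 :=
    funext fun σ => pow_sum_coeff_eq_pow_sum_abs_coeff _ (ρ δ) δ g σ (by decide)
  rw [heq2] at hδk
  linarith

/-- **The renormalised plus-boundary magnetisation functional is eventually bounded**: under the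
hypotheses of `eventually_isingExpect_sq_le_of_tendstoInLaw`, for every test function `g ≥ 0`,
eventually `𝔪_δ(g)² = (|ρ(δ)| δᵈ ∑_{x ∈ box} g(δx) ⟨σₓ⟩⁺_{box;β(δ),0})² ≤ 80 (∫ ω(g)² dμ + 1)`
(`𝔪_δ(g) = ⟨X_g⟩⁺` and `⟨X_g⟩² ≤ ⟨X_g²⟩`). [folklore] -/
theorem eventually_sq_plusMagnetization_le_of_tendstoInLaw {β ρ : ℝ → ℝ} {L : ℝ → ℕ}
    {μ : Measure (FieldConfig (EuclideanSpace ℝ (Fin d)))}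
    (hβ : ∀ δ, 0 ≤ β δ)
    (hlim : TendstoInLaw (fun δ => isingFieldLaw d (β δ) L δ ρ) (𝓝[>] 0) μ)
    (h2μ : ∀ f : 𝓢(EuclideanSpace ℝ (Fin d), ℝ),
      MemLp (fun ω : FieldConfig (EuclideanSpace ℝ (Fin d)) => ω f) 2 μ)
    {g : 𝓢(EuclideanSpace ℝ (Fin d), ℝ)} (hg : ∀ y, 0 ≤ g y) :
    ∀ᶠ δ in 𝓝[>] (0 : ℝ),
      (∑ x ∈ box d (L δ), |ρ δ| * δ ^ d * g (δ • siteToE x) *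
        isingExpect (zdGraph d) (box d (L δ)) (β δ) 0 .plus (spinAt x)) ^ 2 ≤
      80 * (∫ ω, (ω g) ^ 2 ∂μ + 1) := by
  filter_upwards [eventually_isingExpect_sq_le_of_tendstoInLaw hβ hlim h2μ hg] with δ hδ
  refine le_trans ?_ hδ
  set Λ := box d (L δ) with hΛ
  set c : Site d → ℝ := fun x => |ρ δ| * δ ^ d * g (δ • siteToE x) with hc
  set P := isingMeasure (zdGraph d) Λ (β δ) 0 .plus with hPdef
  set X : SpinConfig (Site d) → ℝ := fun σ => ∑ x ∈ Λ, c x * spinAt x σ with hX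
  have hXm : Measurable X := Finset.measurable_sum _ fun x _ => (measurable_spinAt x).const_mul _
  have hXb : ∀ σ, |X σ| ≤ ∑ x ∈ Λ, |c x| := fun σ => abs_sum_coeff_mul_spinAt_le Λ c σ
  -- `⟨X⟩ = ∑ cₓ ⟨σₓ⟩`
  have hmean : isingExpect (zdGraph d) Λ (β δ) 0 .plus X =
      ∑ x ∈ Λ, c x * isingExpect (zdGraph d) Λ (β δ) 0 .plus (spinAt x) := by
    rw [hX, isingExpect_finset_sum' (zdGraph d) Λ 0 .plus (β δ) Λ (fun x σ => c x * spinAt x σ)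
      (fun x => (measurable_spinAt x).const_mul _)]
    exact Finset.sum_congr rfl fun x _ =>
      isingExpect_const_mul' (zdGraph d) Λ 0 .plus (β δ) (c x) (measurable_spinAt x)
  -- `⟨X⟩² ≤ ⟨X²⟩` (the variance is nonnegative)
  have hmem : MemLp X 2 P :=
    MemLp.of_bound hXm.aestronglyMeasurable (∑ x ∈ Λ, |c x|)
      (Eventually.of_forall fun σ => by rw [Real.norm_eq_abs]; exact hXb σ)
  have hvar := variance_nonneg X P
  rw [variance_eq_sub hmem] at hvar
  have h1 : (∫ σ, X σ ∂P) ^ 2 ≤ ∫ σ, (X ^ 2) σ ∂P := by linarith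
  have h2 : ∫ σ, (X ^ 2) σ ∂P = isingExpect (zdGraph d) Λ (β δ) 0 .plus (fun σ => (X σ) ^ 2) := rfl
  have h3 : ∫ σ, X σ ∂P = isingExpect (zdGraph d) Λ (β δ) 0 .plus X := rfl
  rw [h2] at h1
  rw [h3, hmean] at h1
  simpa only [hX, hc, mul_assoc] using h1

end SecondMoments

/-! ### E. The Riesz kernel `‖x - y‖^{2-d}` against bump functions of scale `T`

The a-posteriori hypothesis `HasBoundedNondegenerateTwoPoint μ` bounds the two-point function of
the limit by the Riesz kernel; against the dilates `χ(·/T)` of a fixed bump this gives second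
moments `O(T^{d+2})` (polar coordinates for `∫_{|z|<T} |z|^{2-d} dz = d|B₁|T²/2`, and the trivial
bound `T^{2-d}` off the ball), the scaling that makes the packing argument of section F work in
every `d ≥ 3`. -/

section Riesz

open Metric Set

variable {d : ℕ}

/-- `ℝᵈ` is nontrivial for `d ≥ 1`. [folklore] -/
theorem nontrivial_euclideanSpace_of_one_le (hd : 1 ≤ d) : Nontrivial (EuclideanSpace ℝ (Fin d)) := by
  obtain ⟨k, rfl⟩ : ∃ k, d = k + 1 := ⟨d - 1, by omega⟩
  infer_instance

/-- On `(0, r)` the radial density of the Riesz kernel is `s^{d-1} s^{2-d} = s`. [folklore] -/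
theorem eqOn_pow_mul_rpow_Ioi (hd : 1 ≤ d) (r : ℝ) :
    EqOn (fun s : ℝ => s ^ (d - 1) • (Iio r).indicator (fun s : ℝ => s ^ (2 - (d : ℝ))) s)
      ((Iio r).indicator fun s : ℝ => s) (Ioi 0) := by
  intro s hs
  have hs0 : 0 < s := hs
  by_cases hsr : s < r
  · simp only [smul_eq_mul, indicator, mem_Iio, hsr, if_true]
    have h1 : ((d : ℝ) - 1) + (2 - (d : ℝ)) = 1 := by ring
    rw [← Real.rpow_natCast s (d - 1), ← Real.rpow_add hs0, Nat.cast_sub hd, Nat.cast_one, h1,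
      Real.rpow_one]
  · simp [indicator, hsr]

/-- **The Riesz kernel is integrable on balls**: `z ↦ ‖z‖^{2-d}` is integrable on `B(0,r) ⊆ ℝᵈ`
(`d ≥ 1`; polar coordinates, Mathlib's `integrableOn_fun_norm_addHaar`). [folklore] -/
theorem integrableOn_norm_rpow_ball (hd : 1 ≤ d) (r : ℝ) :
    IntegrableOn (fun z : EuclideanSpace ℝ (Fin d) => ‖z‖ ^ (2 - (d : ℝ))) (ball 0 r) volume := by
  haveI := nontrivial_euclideanSpace_of_one_le hd
  rw [integrableOn_fun_norm_addHaar volume (f := fun y : ℝ => y ^ (2 - (d : ℝ))) (r := r),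
    finrank_euclideanSpace_fin]
  have heq : EqOn (fun y : ℝ => y ^ (d - 1) • y ^ (2 - (d : ℝ))) (fun y => y) (Ioo 0 r) := by
    intro y hy
    have h := (eqOn_pow_mul_rpow_Ioi hd r) (mem_Ioi.2 hy.1)
    simp only [indicator, mem_Iio, hy.2, if_true] at h
    exact h
  refine IntegrableOn.congr_fun ?_ heq.symm measurableSet_Ioo
  exact (continuous_id.integrableOn_Icc (a := 0) (b := r)).mono_set Ioo_subset_Icc_self

/-- **The Riesz kernel integrated over a ball**: `∫_{|z|<r} ‖z‖^{2-d} dz = d |B(0,1)| r²/2` in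
`ℝᵈ`, `d ≥ 1`, `r ≥ 0` (polar coordinates; Folland 1999, Cor. 2.51). [folklore] -/
theorem integral_ball_norm_rpow (hd : 1 ≤ d) {r : ℝ} (hr : 0 ≤ r) :
    ∫ z in ball (0 : EuclideanSpace ℝ (Fin d)) r, ‖z‖ ^ (2 - (d : ℝ)) =
      d * (volume (ball (0 : EuclideanSpace ℝ (Fin d)) 1)).toReal * (r ^ 2 / 2) := by
  haveI := nontrivial_euclideanSpace_of_one_le hd
  have hind : (ball (0 : EuclideanSpace ℝ (Fin d)) r).indicator
      (fun y : EuclideanSpace ℝ (Fin d) => ‖y‖ ^ (2 - (d : ℝ))) =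
      fun y : EuclideanSpace ℝ (Fin d) => (Iio r).indicator (fun s : ℝ => s ^ (2 - (d : ℝ))) ‖y‖ := by
    funext y
    by_cases hy : ‖y‖ < r
    · simp [indicator, hy]
    · simp [indicator, hy]
  rw [← integral_indicator measurableSet_ball, hind,
    integral_fun_norm_addHaar (volume : Measure (EuclideanSpace ℝ (Fin d)))
      (fun s : ℝ => (Iio r).indicator (fun s : ℝ => s ^ (2 - (d : ℝ))) s), finrank_euclideanSpace_fin]
  have hinner : ∫ s in Ioi (0 : ℝ), s ^ (d - 1) • (Iio r).indicator (fun s : ℝ => s ^ (2 - (d : ℝ))) s =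
      r ^ 2 / 2 := by
    rw [setIntegral_congr_fun measurableSet_Ioi (eqOn_pow_mul_rpow_Ioi hd r),
      setIntegral_indicator measurableSet_Iio, Ioi_inter_Iio, ← integral_Ioc_eq_integral_Ioo,
      ← intervalIntegral.integral_of_le hr, integral_id]
    ring
  rw [hinner, measureReal_def]
  simp only [nsmul_eq_mul, smul_eq_mul]
  ring

/-- The translated kernel `y ↦ ‖x - y‖^{2-d}` has the same integral over `B(x, r)`. [folklore] -/
theorem integral_ball_norm_sub_rpow (hd : 1 ≤ d) (x : EuclideanSpace ℝ (Fin d)) {r : ℝ} (hr : 0 ≤ r) :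
    ∫ y in ball x r, ‖x - y‖ ^ (2 - (d : ℝ)) =
      d * (volume (ball (0 : EuclideanSpace ℝ (Fin d)) 1)).toReal * (r ^ 2 / 2) := by
  have hind : (ball x r).indicator (fun y : EuclideanSpace ℝ (Fin d) => ‖x - y‖ ^ (2 - (d : ℝ))) =
      fun y => (ball (0 : EuclideanSpace ℝ (Fin d)) r).indicator
        (fun z : EuclideanSpace ℝ (Fin d) => ‖z‖ ^ (2 - (d : ℝ))) (x - y) := by
    funext y
    have hmem : y ∈ ball x r ↔ x - y ∈ ball (0 : EuclideanSpace ℝ (Fin d)) r := by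
      rw [mem_ball_iff_norm, mem_ball_zero_iff, norm_sub_rev]
    by_cases hy : y ∈ ball x r
    · rw [indicator_of_mem hy, indicator_of_mem (hmem.1 hy)]
    · rw [indicator_of_notMem hy, indicator_of_notMem (fun h => hy (hmem.2 h))]
  rw [← integral_indicator measurableSet_ball, hind,
    integral_sub_left_eq_self (fun z : EuclideanSpace ℝ (Fin d) =>
      (ball (0 : EuclideanSpace ℝ (Fin d)) r).indicator (fun z => ‖z‖ ^ (2 - (d : ℝ))) z) volume x,
    integral_indicator measurableSet_ball, integral_ball_norm_rpow hd hr]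

/-- The translated kernel is integrable on `B(x, r)`. [folklore] -/
theorem integrableOn_norm_sub_rpow_ball (hd : 1 ≤ d) (x : EuclideanSpace ℝ (Fin d)) (r : ℝ) :
    IntegrableOn (fun y : EuclideanSpace ℝ (Fin d) => ‖x - y‖ ^ (2 - (d : ℝ))) (ball x r) volume := by
  have hind : (ball x r).indicator (fun y : EuclideanSpace ℝ (Fin d) => ‖x - y‖ ^ (2 - (d : ℝ))) =
      fun y => (ball (0 : EuclideanSpace ℝ (Fin d)) r).indicator
        (fun z : EuclideanSpace ℝ (Fin d) => ‖z‖ ^ (2 - (d : ℝ))) (x - y) := by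
    funext y
    have hmem : y ∈ ball x r ↔ x - y ∈ ball (0 : EuclideanSpace ℝ (Fin d)) r := by
      rw [mem_ball_iff_norm, mem_ball_zero_iff, norm_sub_rev]
    by_cases hy : y ∈ ball x r
    · rw [indicator_of_mem hy, indicator_of_mem (hmem.1 hy)]
    · rw [indicator_of_notMem hy, indicator_of_notMem (fun h => hy (hmem.2 h))]
  refine (integrable_indicator_iff measurableSet_ball).1 ?_
  rw [hind]
  exact ((integrableOn_norm_rpow_ball hd r).integrable_indicator measurableSet_ball).comp_sub_left x

/-- **The Riesz potential of a bounded integrable function**: for `d ≥ 3`, `|F| ≤ B`, `F ∈ L¹`,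
every `x` and every radius `r > 0`, `y ↦ ‖x - y‖^{2-d} |F(y)|` is integrable and
`∫ ‖x - y‖^{2-d} |F(y)| dy ≤ B · d|B₁|r²/2 + r^{2-d} ‖F‖₁` (the ball `B(x,r)` and its complement).
[folklore] -/
theorem integral_norm_sub_rpow_mul_abs_le (hd : 3 ≤ d) {F : EuclideanSpace ℝ (Fin d) → ℝ}
    (hFi : Integrable F volume) {B : ℝ} (hFB : ∀ y, |F y| ≤ B) (x : EuclideanSpace ℝ (Fin d))
    {r : ℝ} (hr : 0 < r) :
    Integrable (fun y : EuclideanSpace ℝ (Fin d) => ‖x - y‖ ^ (2 - (d : ℝ)) * |F y|) volume ∧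
      ∫ y, ‖x - y‖ ^ (2 - (d : ℝ)) * |F y| ≤
        B * (d * (volume (ball (0 : EuclideanSpace ℝ (Fin d)) 1)).toReal * (r ^ 2 / 2)) +
          r ^ (2 - (d : ℝ)) * ∫ y, |F y| := by
  have hd1 : 1 ≤ d := by omega
  set k : EuclideanSpace ℝ (Fin d) → ℝ := fun y => ‖x - y‖ ^ (2 - (d : ℝ)) with hk
  have hk0 : ∀ y, 0 ≤ k y := fun y => Real.rpow_nonneg (norm_nonneg _) _
  have hkm : Measurable k := (continuous_const.sub continuous_id).norm.measurable.pow_const _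
  have hB0 : 0 ≤ B := (abs_nonneg _).trans (hFB x)
  have hFam : AEStronglyMeasurable (fun y => |F y|) volume := hFi.abs.aestronglyMeasurable
  -- inside the ball
  set g₁ : EuclideanSpace ℝ (Fin d) → ℝ := (ball x r).indicator fun y => |F y| * k y with hg₁
  have hint₁ : IntegrableOn (fun y => |F y| * k y) (ball x r) volume :=
    Integrable.bdd_mul (integrableOn_norm_sub_rpow_ball hd1 x r) hFam.restrict
      (c := B) (Eventually.of_forall fun y => by rw [Real.norm_eq_abs, abs_abs]; exact hFB y)
  have hg₁i : Integrable g₁ volume := hint₁.integrable_indicator measurableSet_ball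
  have hg₁le : ∫ y, g₁ y ≤ B * (d * (volume (ball (0 : EuclideanSpace ℝ (Fin d)) 1)).toReal *
      (r ^ 2 / 2)) := by
    rw [hg₁, integral_indicator measurableSet_ball, ← integral_ball_norm_sub_rpow hd1 x hr.le,
      ← integral_const_mul]
    refine setIntegral_mono_on hint₁ ((integrableOn_norm_sub_rpow_ball hd1 x r).const_mul B)
      measurableSet_ball fun y _ => ?_
    exact mul_le_mul_of_nonneg_right (hFB y) (hk0 y)
  -- outside the ball
  set g₂ : EuclideanSpace ℝ (Fin d) → ℝ := (ball x r)ᶜ.indicator fun y => |F y| * k y with hg₂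
  have hkout : ∀ y ∈ (ball x r)ᶜ, k y ≤ r ^ (2 - (d : ℝ)) := by
    intro y hy
    rw [mem_compl_iff, mem_ball_iff_norm, not_lt, norm_sub_rev] at hy
    exact Real.rpow_le_rpow_of_nonpos hr hy (by
      have : (3 : ℝ) ≤ d := by exact_mod_cast hd
      linarith)
  have hg₂m : AEStronglyMeasurable g₂ volume :=
    (hFam.mul hkm.aestronglyMeasurable).indicator measurableSet_ball.compl
  have hg₂bd : ∀ y, ‖g₂ y‖ ≤ r ^ (2 - (d : ℝ)) * |F y| := by
    intro y
    rw [Real.norm_eq_abs, hg₂]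
    by_cases hy : y ∈ (ball x r)ᶜ
    · rw [indicator_of_mem hy, abs_of_nonneg (mul_nonneg (abs_nonneg _) (hk0 y)), mul_comm]
      exact mul_le_mul_of_nonneg_right (hkout y hy) (abs_nonneg _)
    · rw [indicator_of_notMem hy, abs_zero]
      exact mul_nonneg (Real.rpow_nonneg hr.le _) (abs_nonneg _)
  have hg₂i : Integrable g₂ volume :=
    Integrable.mono' (hFi.abs.const_mul _) hg₂m (Eventually.of_forall hg₂bd)
  have hg₂le : ∫ y, g₂ y ≤ r ^ (2 - (d : ℝ)) * ∫ y, |F y| := by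
    rw [← integral_const_mul]
    exact integral_mono hg₂i (hFi.abs.const_mul _) fun y => (le_abs_self _).trans
      (by rw [← Real.norm_eq_abs]; exact hg₂bd y)
  -- assemble
  have hsplit : (fun y => k y * |F y|) = fun y => g₁ y + g₂ y := by
    funext y
    rw [hg₁, hg₂]
    by_cases hy : y ∈ ball x r
    · rw [indicator_of_mem hy, indicator_of_notMem (fun h => Set.notMem_of_mem_compl h hy), add_zero,
        mul_comm]
    · rw [indicator_of_notMem hy, indicator_of_mem (mem_compl hy), zero_add, mul_comm]
  refine ⟨by rw [hsplit]; exact hg₁i.add hg₂i, ?_⟩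
  rw [hsplit, integral_add hg₁i hg₂i]
  exact add_le_add hg₁le hg₂le

/-- **Double integrals against a kernel bounded by the Riesz kernel**: for `d ≥ 3`,
`|S₂(x,y)| ≤ C ‖x - y‖^{2-d}`, `|F| ≤ B`, `F ∈ L¹` and `r > 0`,
`|∫∫ S₂(x,y) F(x) F(y) dx dy| ≤ ‖F‖₁ · C (B d|B₁|r²/2 + r^{2-d} ‖F‖₁)` (iterated Bochner
integrals, as in `HasBoundedNondegenerateTwoPoint`). [folklore] -/
theorem abs_integral_integral_kernel_le (hd : 3 ≤ d)
    {S₂ : EuclideanSpace ℝ (Fin d) → EuclideanSpace ℝ (Fin d) → ℝ} {C : ℝ} (hC : 0 ≤ C)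
    (hS₂ : ∀ x y, |S₂ x y| ≤ C * ‖x - y‖ ^ (2 - (d : ℝ)))
    {F : EuclideanSpace ℝ (Fin d) → ℝ} (hFi : Integrable F volume) {B : ℝ} (hFB : ∀ y, |F y| ≤ B)
    {r : ℝ} (hr : 0 < r) :
    |∫ x, ∫ y, S₂ x y * F x * F y| ≤
      (∫ y, |F y|) * (C * (B * (d * (volume (ball (0 : EuclideanSpace ℝ (Fin d)) 1)).toReal *
        (r ^ 2 / 2)) + r ^ (2 - (d : ℝ)) * ∫ y, |F y|)) := by
  set K : ℝ := C * (B * (d * (volume (ball (0 : EuclideanSpace ℝ (Fin d)) 1)).toReal *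
    (r ^ 2 / 2)) + r ^ (2 - (d : ℝ)) * ∫ y, |F y|) with hK
  have hinner : ∀ x, |∫ y, S₂ x y * F x * F y| ≤ K * |F x| := by
    intro x
    obtain ⟨hint, hle⟩ := integral_norm_sub_rpow_mul_abs_le hd hFi hFB x hr
    calc |∫ y, S₂ x y * F x * F y| ≤ ∫ y, |S₂ x y * F x * F y| := by
          have h := norm_integral_le_integral_norm (μ := volume) (fun y => S₂ x y * F x * F y)
          simpa only [Real.norm_eq_abs] using h
      _ ≤ ∫ y, C * |F x| * (‖x - y‖ ^ (2 - (d : ℝ)) * |F y|) := by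
          refine integral_mono_of_nonneg (Eventually.of_forall fun y => abs_nonneg _)
            (hint.const_mul (C * |F x|)) (Eventually.of_forall fun y => ?_)
          show |S₂ x y * F x * F y| ≤ C * |F x| * (‖x - y‖ ^ (2 - (d : ℝ)) * |F y|)
          rw [abs_mul, abs_mul]
          calc |S₂ x y| * |F x| * |F y| ≤ C * ‖x - y‖ ^ (2 - (d : ℝ)) * |F x| * |F y| := by
                gcongr
                exact hS₂ x y
            _ = C * |F x| * (‖x - y‖ ^ (2 - (d : ℝ)) * |F y|) := by ring
      _ = C * |F x| * ∫ y, ‖x - y‖ ^ (2 - (d : ℝ)) * |F y| := integral_const_mul _ _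
      _ ≤ C * |F x| * (B * (d * (volume (ball (0 : EuclideanSpace ℝ (Fin d)) 1)).toReal *
          (r ^ 2 / 2)) + r ^ (2 - (d : ℝ)) * ∫ y, |F y|) :=
          mul_le_mul_of_nonneg_left hle (mul_nonneg hC (abs_nonneg _))
      _ = K * |F x| := by rw [hK]; ring
  calc |∫ x, ∫ y, S₂ x y * F x * F y| ≤ ∫ x, |∫ y, S₂ x y * F x * F y| := by
        have h := norm_integral_le_integral_norm (μ := volume) (fun x => ∫ y, S₂ x y * F x * F y)
        simpa only [Real.norm_eq_abs] using h
    _ ≤ ∫ x, K * |F x| :=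
        integral_mono_of_nonneg (Eventually.of_forall fun x => abs_nonneg _) (hFi.abs.const_mul K)
          (Eventually.of_forall hinner)
    _ = (∫ y, |F y|) * K := by rw [integral_const_mul, mul_comm]

/-! #### Bump functions of scale `T` -/

variable (d) in
/-- A bump on `ℝᵈ` equal to `1` on the ball of radius `√d + 1` (which contains the unit cube for
the sup norm) and supported in the ball of radius `√d + 2`. [folklore] -/
private def plateauBump : ContDiffBump (0 : EuclideanSpace ℝ (Fin d)) :=
  ⟨Real.sqrt d + 1, Real.sqrt d + 2, by positivity, by linarith⟩

/-- The dilate `χ(y/T)` of the plateau bump. [folklore] -/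
private def bumpDilate (T : ℝ) : EuclideanSpace ℝ (Fin d) → ℝ := fun y => plateauBump d (T⁻¹ • y)

/-- `0 ≤ χ(y/T)`. [folklore] -/
private theorem bumpDilate_nonneg (T : ℝ) (y : EuclideanSpace ℝ (Fin d)) : 0 ≤ bumpDilate T y :=
  (plateauBump d).nonneg

/-- `χ(y/T) ≤ 1`. [folklore] -/
private theorem bumpDilate_le_one (T : ℝ) (y : EuclideanSpace ℝ (Fin d)) : bumpDilate T y ≤ 1 :=
  (plateauBump d).le_one

/-- `|χ(y/T)| ≤ 1`. [folklore] -/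
private theorem abs_bumpDilate_le_one (T : ℝ) (y : EuclideanSpace ℝ (Fin d)) : |bumpDilate T y| ≤ 1 := by
  rw [abs_of_nonneg (bumpDilate_nonneg T y)]
  exact bumpDilate_le_one T y

/-- The sup-norm cube of side `T` lies in the Euclidean ball of radius `√d · T`. [folklore] -/
theorem norm_le_sqrt_mul_of_forall_abs_le {T : ℝ} (hT : 0 ≤ T) {y : EuclideanSpace ℝ (Fin d)}
    (hy : ∀ i, |y i| ≤ T) : ‖y‖ ≤ Real.sqrt d * T := by
  rw [EuclideanSpace.norm_eq]
  have hsum : ∑ i, ‖y i‖ ^ 2 ≤ d * T ^ 2 := by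
    calc ∑ i, ‖y i‖ ^ 2 ≤ ∑ _i : Fin d, T ^ 2 :=
          Finset.sum_le_sum fun i _ => by
            rw [Real.norm_eq_abs]
            exact pow_le_pow_left₀ (abs_nonneg _) (hy i) 2
      _ = d * T ^ 2 := by simp
  calc Real.sqrt (∑ i, ‖y i‖ ^ 2) ≤ Real.sqrt (d * T ^ 2) := Real.sqrt_le_sqrt hsum
    _ = Real.sqrt d * T := by rw [Real.sqrt_mul (Nat.cast_nonneg d), Real.sqrt_sq hT]

/-- `χ(y/T) = 1` on the sup-norm cube of side `T` (`T > 0`). [folklore] -/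
private theorem bumpDilate_eq_one_of_forall_abs_le {T : ℝ} (hT : 0 < T) {y : EuclideanSpace ℝ (Fin d)}
    (hy : ∀ i, |y i| ≤ T) : bumpDilate T y = 1 := by
  unfold bumpDilate
  refine (plateauBump d).one_of_mem_closedBall ?_
  rw [mem_closedBall, dist_zero_right, norm_smul, Real.norm_eq_abs, abs_of_pos (inv_pos.2 hT)]
  have h := norm_le_sqrt_mul_of_forall_abs_le hT.le hy
  calc T⁻¹ * ‖y‖ ≤ T⁻¹ * (Real.sqrt d * T) := mul_le_mul_of_nonneg_left h (inv_pos.2 hT).le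
    _ = Real.sqrt d := by field_simp
    _ ≤ (plateauBump d).rIn := by change Real.sqrt d ≤ Real.sqrt d + 1; linarith

/-- `χ(·/T)` is smooth. [folklore] -/
private theorem contDiff_bumpDilate (T : ℝ) : ContDiff ℝ (⊤ : ℕ∞) (bumpDilate (d := d) T) :=
  (plateauBump d).contDiff.comp (contDiff_const_smul T⁻¹)

/-- `χ(·/T)` has compact support (`T ≠ 0`). [folklore] -/
private theorem hasCompactSupport_bumpDilate {T : ℝ} (hT : T ≠ 0) :
    HasCompactSupport (bumpDilate (d := d) T) :=
  (plateauBump d).hasCompactSupport.comp_smul (inv_ne_zero hT)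

/-- `χ(·/T)` as a Schwartz test function. [folklore] -/
private def bumpDilateSchwartz {T : ℝ} (hT : T ≠ 0) : 𝓢(EuclideanSpace ℝ (Fin d), ℝ) :=
  (hasCompactSupport_bumpDilate (d := d) hT).toSchwartzMap (contDiff_bumpDilate T)

/-- The Schwartz function `χ(·/T)` evaluates as `bumpDilate T`. [folklore] -/
@[simp] private theorem bumpDilateSchwartz_apply {T : ℝ} (hT : T ≠ 0) (y : EuclideanSpace ℝ (Fin d)) :
    bumpDilateSchwartz (d := d) hT y = bumpDilate T y := rfl

/-- `χ(·/T)` is integrable. [folklore] -/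
private theorem integrable_bumpDilate {T : ℝ} (hT : T ≠ 0) : Integrable (bumpDilate (d := d) T) volume :=
  (contDiff_bumpDilate T).continuous.integrable_of_hasCompactSupport (hasCompactSupport_bumpDilate hT)

/-- `‖χ(·/T)‖₁ = Tᵈ ‖χ‖₁`. [folklore] -/
private theorem integral_abs_bumpDilate {T : ℝ} (hT : 0 < T) :
    ∫ y, |bumpDilate (d := d) T y| = T ^ d * ∫ y, (plateauBump d) y := by
  have h1 : (fun y => |bumpDilate (d := d) T y|) = fun y => (plateauBump d) (T⁻¹ • y) :=
    funext fun y => abs_of_nonneg (bumpDilate_nonneg T y)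
  rw [h1, Measure.integral_comp_inv_smul_of_nonneg volume (plateauBump d) hT.le,
    finrank_euclideanSpace_fin, smul_eq_mul]

/-- **Second moments of the limit law against bumps of scale `T` are `O(T^{d+2})`**: if
`μ` has bounded non-degenerate two-point function (`HasBoundedNondegenerateTwoPoint`, ADC 2021,
hypothesis of Thm 1.2) on `ℝᵈ`, `d ≥ 3`, then there is `K₁` with
`∫ ω(χ(·/T))² dμ ≤ K₁ T^{d+2}` for all `T ≥ 1`. [cite: AizenmanDuminilCopinAnnals2021, Thm 1.2 (hypothesis "bounded non-degenerate two-point function"), p. 4] -/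
private theorem exists_integral_sq_eval_bumpDilate_le (hd : 3 ≤ d)
    {μ : Measure (FieldConfig (EuclideanSpace ℝ (Fin d)))} (hS : HasBoundedNondegenerateTwoPoint μ) :
    ∃ K₁ : ℝ, 0 ≤ K₁ ∧ ∀ (T : ℝ) (hT : 1 ≤ T),
      ∫ ω, (ω (bumpDilateSchwartz (d := d) (by positivity : T ≠ 0))) ^ 2 ∂μ ≤ K₁ * T ^ (d + 2) := by
  obtain ⟨_, S₂, hS₂, ⟨C, hC⟩, _⟩ := hS
  set C' : ℝ := max C 0 with hC'
  have hC'0 : 0 ≤ C' := le_max_right _ _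
  have hker : ∀ x y : EuclideanSpace ℝ (Fin d), |S₂ x y| ≤ C' * ‖x - y‖ ^ (2 - (d : ℝ)) := by
    intro x y
    have h := hC x y
    rw [finrank_euclideanSpace_fin] at h
    have hexp : (-((d : ℝ) - 2)) = 2 - (d : ℝ) := by ring
    rw [hexp] at h
    exact h.trans (mul_le_mul_of_nonneg_right (le_max_left _ _) (Real.rpow_nonneg (norm_nonneg _) _))
  set Iχ : ℝ := ∫ y, (plateauBump d) y with hIχ
  have hIχ0 : 0 ≤ Iχ := integral_nonneg fun y => (plateauBump d).nonneg
  set v₁ : ℝ := (volume (ball (0 : EuclideanSpace ℝ (Fin d)) 1)).toReal with hv₁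
  refine ⟨Iχ * (C' * (d * v₁ / 2 + Iχ)), by positivity, fun T hT => ?_⟩
  have hT0 : 0 < T := by linarith
  set F : EuclideanSpace ℝ (Fin d) → ℝ := bumpDilate T with hF
  have hFi : Integrable F volume := integrable_bumpDilate hT0.ne'
  have h1 : ∫ ω, (ω (bumpDilateSchwartz (d := d) (by positivity : T ≠ 0))) ^ 2 ∂μ =
      ∫ x, ∫ y, S₂ x y * F x * F y := by
    have h := hS₂ (bumpDilateSchwartz (d := d) (by positivity : T ≠ 0))
      (bumpDilateSchwartz (d := d) (by positivity : T ≠ 0))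
    rw [Literature.MathematicalPhysics.QuantumLattice.twoPoint] at h
    simp only [bumpDilateSchwartz_apply] at h
    rw [← h]
    exact integral_congr_ae (Eventually.of_forall fun ω => by simp [sq])
  have hL1 : ∫ y, |F y| = T ^ d * Iχ := integral_abs_bumpDilate hT0
  have h2 := abs_integral_integral_kernel_le hd hC'0 hker hFi (fun y => abs_bumpDilate_le_one T y) hT0
  rw [hL1] at h2
  rw [h1]
  refine (le_abs_self _).trans (h2.trans ?_)
  -- `T^{2-d} T^d = T²`
  have hpow : T ^ (2 - (d : ℝ)) * T ^ d = T ^ 2 := by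
    rw [← Real.rpow_natCast T d, ← Real.rpow_add hT0]
    have : (2 - (d : ℝ)) + (d : ℝ) = 2 := by ring
    rw [this, Real.rpow_two]
  have hTd : T ^ (d + 2) = T ^ d * T ^ 2 := by ring
  have hEq : T ^ d * Iχ * (C' * (1 * (↑d * v₁ * (T ^ 2 / 2)) + T ^ (2 - (d : ℝ)) * (T ^ d * Iχ))) =
      Iχ * (C' * (d * v₁ / 2 + Iχ)) * T ^ (d + 2) := by
    have : T ^ (2 - (d : ℝ)) * (T ^ d * Iχ) = T ^ 2 * Iχ := by rw [← mul_assoc, hpow]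
    rw [this, hTd]; ring
  exact hEq.le

end Riesz

/-! ### F. The plus magnetisation near the origin: packing outward translates

Fix `δ` and the plus box `Λ = box d (L δ)`. By section A the magnetisation profile `x ↦ ⟨σₓ⟩⁺_Λ`
increases under outward translations, so `kᵈ` disjoint outward translates of the near cube
`box d n` (`n ≈ R/δ`, one family per orthant) each carry at least its mass, while all of them fit
in a cube of continuum side `T ≈ k R` on which a bump `χ_T ≡ 1`; hence
`kᵈ · 𝔪_δ(1_{near}) ≤ 𝔪_δ(χ_T) ≲ T^{d/2+1}` (sections D, E), i.e. `𝔪_δ(1_{near}) ≲ k^{1-d/2} → 0`. -/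

section NearRegion

variable {d : ℕ}

/-- The sign `±1 ∈ ℤ` attached to a Boolean (orthant bookkeeping). [folklore] -/
private def bsgn (b : Bool) : ℤ := if b then 1 else -1

/-- The part of the cube `box d n` in the closed orthant `o`. [folklore] -/
private def orthBox (n : ℕ) (o : Fin d → Bool) : Finset (Site d) :=
  (box d n).filter fun x => ∀ i, 0 ≤ bsgn (o i) * x i

/-- Membership in `orthBox`. [folklore] -/
private theorem mem_orthBox {n : ℕ} {o : Fin d → Bool} {x : Site d} :
    x ∈ orthBox n o ↔ x ∈ box d n ∧ ∀ i, 0 ≤ bsgn (o i) * x i := by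
  simp [orthBox]

/-- The outward translation vector of the orthant `o` indexed by `j`: `± (jᵢ + 1)(2n + 1)` in the
`i`-th coordinate. [folklore] -/
private def transVec (n : ℕ) (o : Fin d → Bool) (j : Fin d → ℕ) : Site d :=
  fun i => bsgn (o i) * (((j i + 1) * (2 * n + 1) : ℕ) : ℤ)

/-- **The orthants cover the cube**: for `m ≥ 0`, `∑_{box d n} m ≤ ∑_o ∑_{orthBox n o} m`. [folklore] -/
private theorem sum_box_le_sum_orthBox (n : ℕ) {m : Site d → ℝ} (hm : ∀ x ∈ box d n, 0 ≤ m x) :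
    ∑ x ∈ box d n, m x ≤ ∑ o : Fin d → Bool, ∑ x ∈ orthBox n o, m x := by
  classical
  have hrw : ∀ o : Fin d → Bool, ∑ x ∈ orthBox n o, m x =
      ∑ x ∈ box d n, if (∀ i, 0 ≤ bsgn (o i) * x i) then m x else 0 := fun o => by
    rw [orthBox, Finset.sum_filter]
  simp_rw [hrw]
  rw [Finset.sum_comm]
  refine Finset.sum_le_sum fun x hx => ?_
  -- the orthant of `x` itself contributes `m x`
  set ox : Fin d → Bool := fun i => decide (0 ≤ x i) with hox
  have hPx : ∀ i, 0 ≤ bsgn (ox i) * x i := by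
    intro i
    by_cases hi : 0 ≤ x i
    · simp [hox, bsgn, hi]
    · simp [hox, bsgn, hi]; omega
  have key : (if (∀ i, 0 ≤ bsgn (ox i) * x i) then m x else 0) ≤
      ∑ o : Fin d → Bool, if (∀ i, 0 ≤ bsgn (o i) * x i) then m x else 0 :=
    Finset.single_le_sum (f := fun o : Fin d → Bool =>
      if (∀ i, 0 ≤ bsgn (o i) * x i) then m x else 0) (fun o _ => by
        split_ifs
        · exact hm x hx
        · exact le_rfl) (Finset.mem_univ ox)
  rwa [if_pos hPx] at key

/-- A translate of an orthant piece lies in the big cube `box d ((k+1)(2n+1))`. [folklore] -/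
private theorem add_transVec_mem_box {n k : ℕ} {o : Fin d → Bool} {j : Fin d → ℕ} (hj : ∀ i, j i < k)
    {x : Site d} (hx : x ∈ orthBox n o) :
    x + transVec n o j ∈ box d ((k + 1) * (2 * n + 1)) := by
  rw [mem_orthBox, mem_box] at hx
  rw [mem_box]
  intro i
  obtain ⟨hxb, hxs⟩ := hx
  have h1 := hxb i
  have h2 := hxs i
  have hu : ((j i + 1) * (2 * n + 1) : ℕ) ≤ k * (2 * n + 1) := Nat.mul_le_mul_right _ (hj i)
  have hN : (((k + 1) * (2 * n + 1) : ℕ) : ℤ) = (k * (2 * n + 1) : ℕ) + (2 * n + 1 : ℕ) := by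
    push_cast; ring
  simp only [Pi.add_apply, transVec]
  rw [hN]
  set u : ℕ := (j i + 1) * (2 * n + 1) with hu_def
  set v : ℕ := k * (2 * n + 1) with hv_def
  have huv : (u : ℤ) ≤ v := by exact_mod_cast hu
  cases hoi : o i <;> simp only [hoi, bsgn, if_true, if_false, Bool.false_eq_true] at h2 ⊢ <;>
    push_cast <;> omega

/-- **Distinct translates of orthant pieces are disjoint**: if `x + t(o,j) = x' + t(o',j')` with
`x ∈ orthBox n o`, `x' ∈ orthBox n o'`, then `o = o'` and `j = j'`. [folklore] -/
private theorem eq_of_add_transVec_eq {n : ℕ} {o o' : Fin d → Bool} {j j' : Fin d → ℕ} {x x' : Site d}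
    (hx : x ∈ orthBox n o) (hx' : x' ∈ orthBox n o')
    (h : x + transVec n o j = x' + transVec n o' j') : o = o' ∧ j = j' := by
  rw [mem_orthBox, mem_box] at hx hx'
  obtain ⟨hxb, hxs⟩ := hx
  obtain ⟨hxb', hxs'⟩ := hx'
  have hcoord : ∀ i, x i + transVec n o j i = x' i + transVec n o' j' i := fun i => by
    have := congrFun h i
    simpa using this
  -- one unit of the translation step exceeds the width of the pieces
  have hgap : ∀ a b : ℕ, a < b →
      (((a + 1) * (2 * n + 1) : ℕ) : ℤ) + ((2 * n + 1 : ℕ) : ℤ) ≤ (((b + 1) * (2 * n + 1) : ℕ) : ℤ) := by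
    intro a b hab
    have : (a + 1 + 1) * (2 * n + 1) ≤ (b + 1) * (2 * n + 1) := Nat.mul_le_mul_right _ (by omega)
    have h' : (a + 1) * (2 * n + 1) + (2 * n + 1) ≤ (b + 1) * (2 * n + 1) := by linarith [this]
    exact_mod_cast h'
  have hpos : ∀ a : ℕ, ((2 * n + 1 : ℕ) : ℤ) ≤ (((a + 1) * (2 * n + 1) : ℕ) : ℤ) := fun a => by
    exact_mod_cast Nat.le_mul_of_pos_left _ (Nat.succ_pos a)
  -- coordinatewise analysis
  have hi : ∀ i, o i = o' i ∧ j i = j' i := by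
    intro i
    have h1 := hxs i; have h2 := hxs' i; have h3 := hcoord i
    have hb := hxb i; have hb' := hxb' i
    have hp := hpos (j i); have hp' := hpos (j' i)
    simp only [transVec] at h3
    set u : ℤ := (((j i + 1) * (2 * n + 1) : ℕ) : ℤ) with hu
    set u' : ℤ := (((j' i + 1) * (2 * n + 1) : ℕ) : ℤ) with hu'
    set M : ℤ := ((2 * n + 1 : ℕ) : ℤ) with hM
    have hMn : M = 2 * n + 1 := by rw [hM]; push_cast; ring
    rcases Bool.eq_false_or_eq_true (o i) with hoi | hoi <;>
      rcases Bool.eq_false_or_eq_true (o' i) with hoi' | hoi' <;>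
      simp only [hoi, hoi', bsgn, if_true, if_false, Bool.false_eq_true] at h1 h2 h3 ⊢
    · -- `o i = o' i = true`
      refine ⟨trivial, ?_⟩
      by_contra hne
      rcases lt_or_gt_of_ne hne with hlt | hlt
      · have hg := hgap _ _ hlt; omega
      · have hg := hgap _ _ hlt; omega
    · exfalso; omega
    · exfalso; omega
    · refine ⟨trivial, ?_⟩
      by_contra hne
      rcases lt_or_gt_of_ne hne with hlt | hlt
      · have hg := hgap _ _ hlt; omega
      · have hg := hgap _ _ hlt; omega
  exact ⟨funext fun i => (hi i).1, funext fun i => (hi i).2⟩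

/-- The translation of an orthant piece is outward (sign-compatible with the one-point
Messager–Miracle-Solé inequality `isingExpect_plus_spinAt_le_add_of_outward`). [folklore] -/
private theorem transVec_outward {n : ℕ} {o : Fin d → Bool} (j : Fin d → ℕ) {x : Site d}
    (hx : x ∈ orthBox n o) (i : Fin d) :
    (0 ≤ x i ∧ 0 ≤ transVec n o j i) ∨ (x i ≤ 0 ∧ transVec n o j i ≤ 0) := by
  rw [mem_orthBox] at hx
  have h2 := hx.2 i
  simp only [transVec]
  have hu : (0 : ℤ) ≤ (((j i + 1) * (2 * n + 1) : ℕ) : ℤ) := by positivity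
  set u : ℤ := (((j i + 1) * (2 * n + 1) : ℕ) : ℤ)
  rcases Bool.eq_false_or_eq_true (o i) with hoi | hoi <;>
    simp only [hoi, bsgn, if_true, if_false, Bool.false_eq_true] at h2 ⊢
  · left; constructor <;> omega
  · right; constructor <;> omega

/-- **Packing bound for the plus magnetisation of a box.** For `β, h ≥ 0`, `k ≥ 1` and
`(k+1)(2n+1) ≤ L`, writing `m(x) = ⟨σₓ⟩⁺_{box d L;β,h}` and given weights `w ≥ 0` on `box d L`
with `w = 1` on `box d ((k+1)(2n+1))`:
`kᵈ ∑_{x ∈ box d n} m(x) ≤ ∑_{y ∈ box d L} w(y) m(y)`. Each of the `kᵈ` outward translates (per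
orthant) of the near cube carries at least its magnetisation (one-point Messager–Miracle-Solé,
`isingExpect_plus_spinAt_le_add_of_outward`), the translates are disjoint and fit in
`box d ((k+1)(2n+1))`, and `m ≥ 0` (Griffiths). [cite: MessagerMiracleSoleJSP1977, main theorem (monotonicity of ⟨σ₀σ_x⟩ under reflections)] -/
theorem pow_mul_sum_box_plusMagnetization_le {β h : ℝ} (hβ : 0 ≤ β) (hh : 0 ≤ h) {L n k : ℕ}
    (hNL : (k + 1) * (2 * n + 1) ≤ L) {w : Site d → ℝ} (hw0 : ∀ y ∈ box d L, 0 ≤ w y)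
    (hw1 : ∀ y ∈ box d ((k + 1) * (2 * n + 1)), w y = 1) :
    (k : ℝ) ^ d * ∑ x ∈ box d n, isingExpect (zdGraph d) (box d L) β h .plus (spinAt x) ≤
      ∑ y ∈ box d L, w y * isingExpect (zdGraph d) (box d L) β h .plus (spinAt y) := by
  classical
  set N : ℕ := (k + 1) * (2 * n + 1) with hN
  set m : Site d → ℝ := fun x => isingExpect (zdGraph d) (box d L) β h .plus (spinAt x) with hm
  have hboxN : box d N ⊆ box d L := box_mono d hNL
  have hnN : n ≤ N := by
    rw [hN]
    calc n ≤ 2 * n + 1 := by omega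
      _ = 1 * (2 * n + 1) := (one_mul _).symm
      _ ≤ (k + 1) * (2 * n + 1) := Nat.mul_le_mul_right _ (by omega)
  have hboxn : box d n ⊆ box d L := (box_mono d hnN).trans hboxN
  -- Griffiths: `m ≥ 0` (GKS I, for general `h ≥ 0`)
  have hm0' : ∀ x ∈ box d L, 0 ≤ m x := by
    intro x hx
    have hs : spinProduct ({x} : Finset (Site d)) = spinAt x := by funext s; simp [spinProduct]
    have h1 := GKSInequalities.gks_one_holds (zdGraph d) (Λ := box d L) (A := {x}) (β := β) (h := h)
      (bc := .plus) hβ hh (Or.inr rfl) (Finset.singleton_subset_iff.2 hx)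
    rwa [isingCorr, hs] at h1
  -- the translates
  set A : (Fin d → Bool) × (Fin d → Fin k) → Finset (Site d) := fun p =>
    (orthBox n p.1).map (addRightEmbedding (transVec n p.1 (fun i => (p.2 i : ℕ)))) with hA
  have hAsub : ∀ p, A p ⊆ box d N := by
    rintro ⟨o, j⟩ y hy
    obtain ⟨x, hx, rfl⟩ := Finset.mem_map.1 hy
    exact add_transVec_mem_box (fun i => (j i).isLt) hx
  have hdisj : ((Finset.univ : Finset ((Fin d → Bool) × (Fin d → Fin k))) :
      Set ((Fin d → Bool) × (Fin d → Fin k))).PairwiseDisjoint A := by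
    rintro ⟨o, j⟩ _ ⟨o', j'⟩ _ hne
    refine Finset.disjoint_left.2 fun y hy hy' => hne ?_
    obtain ⟨x, hx, rfl⟩ := Finset.mem_map.1 hy
    obtain ⟨x', hx', hxx'⟩ := Finset.mem_map.1 hy'
    rw [addRightEmbedding_apply, addRightEmbedding_apply] at hxx'
    obtain ⟨ho, hj⟩ := eq_of_add_transVec_eq hx' hx hxx'
    refine Prod.ext ho.symm (funext fun i => Fin.ext ?_)
    have := congrFun hj i
    exact this.symm
  -- (1) orthants and the constant sum over `j`
  have hcard : (Fintype.card (Fin d → Fin k) : ℝ) = (k : ℝ) ^ d := by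
    rw [Fintype.card_fun, Fintype.card_fin, Fintype.card_fin]; push_cast; ring
  have h1 : (k : ℝ) ^ d * ∑ x ∈ box d n, m x ≤
      ∑ o : Fin d → Bool, ∑ _j : Fin d → Fin k, ∑ x ∈ orthBox n o, m x := by
    have hle := sum_box_le_sum_orthBox n (m := m) (fun x hx => hm0' x (hboxn hx))
    calc (k : ℝ) ^ d * ∑ x ∈ box d n, m x ≤ (k : ℝ) ^ d * ∑ o : Fin d → Bool, ∑ x ∈ orthBox n o, m x :=
          mul_le_mul_of_nonneg_left hle (by positivity)
      _ = ∑ o : Fin d → Bool, (k : ℝ) ^ d * ∑ x ∈ orthBox n o, m x := Finset.mul_sum _ _ _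
      _ = ∑ o : Fin d → Bool, ∑ _j : Fin d → Fin k, ∑ x ∈ orthBox n o, m x := by
          refine Finset.sum_congr rfl fun o _ => ?_
          rw [Finset.sum_const, Finset.card_univ, nsmul_eq_mul, hcard]
  -- (2) each translate carries at least the mass of its orthant piece
  have h2 : ∀ (o : Fin d → Bool) (j : Fin d → Fin k),
      ∑ x ∈ orthBox n o, m x ≤ ∑ y ∈ A (o, j), m y := by
    intro o j
    rw [Finset.sum_map]
    refine Finset.sum_le_sum fun x hx => ?_
    rw [addRightEmbedding_apply]
    have hxL : x ∈ box d L := hboxn (mem_orthBox.1 hx).1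
    have hxtL : x + transVec n o (fun i => (j i : ℕ)) ∈ box d L :=
      hboxN (add_transVec_mem_box (fun i => (j i).isLt) hx)
    exact isingExpect_plus_spinAt_le_add_of_outward hβ hh hxL hxtL
      (transVec_outward (fun i => (j i : ℕ)) hx)
  -- (3) disjoint union inside `box d N`, where `w = 1`
  have h3 : ∑ o : Fin d → Bool, ∑ j : Fin d → Fin k, ∑ y ∈ A (o, j), m y ≤ ∑ y ∈ box d L, w y * m y := by
    have hunion : ∑ o : Fin d → Bool, ∑ j : Fin d → Fin k, ∑ y ∈ A (o, j), m y =
        ∑ y ∈ (Finset.univ : Finset ((Fin d → Bool) × (Fin d → Fin k))).biUnion A, m y := by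
      rw [Finset.sum_biUnion hdisj]
      exact (Fintype.sum_prod_type' (fun o j => ∑ y ∈ A (o, j), m y)).symm
    rw [hunion]
    have hUsub : (Finset.univ : Finset ((Fin d → Bool) × (Fin d → Fin k))).biUnion A ⊆ box d N :=
      Finset.biUnion_subset.2 fun p _ => hAsub p
    calc ∑ y ∈ Finset.univ.biUnion A, m y ≤ ∑ y ∈ box d N, m y :=
          Finset.sum_le_sum_of_subset_of_nonneg hUsub fun y hy _ => hm0' y (hboxN hy)
      _ = ∑ y ∈ box d N, w y * m y := Finset.sum_congr rfl fun y hy => by rw [hw1 y hy, one_mul]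
      _ ≤ ∑ y ∈ box d L, w y * m y :=
          Finset.sum_le_sum_of_subset_of_nonneg hboxN fun y hy _ => mul_nonneg (hw0 y hy) (hm0' y hy)
  calc (k : ℝ) ^ d * ∑ x ∈ box d n, m x ≤ _ := h1
    _ ≤ ∑ o : Fin d → Bool, ∑ j : Fin d → Fin k, ∑ y ∈ A (o, j), m y :=
        Finset.sum_le_sum fun o _ => Finset.sum_le_sum fun j _ => h2 o j
    _ ≤ _ := h3

/-- **The renormalised plus magnetisation of the near cube vanishes.** Under convergence in law
of the plus-box laws (`β(δ) ≥ 0`, `δ L(δ) → ∞`) to a law `μ` with bounded non-degenerate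
two-point function (`d ≥ 3`): for every `R > 0` and `ε > 0`, eventually
`|ρ(δ)| δᵈ ∑_{x ∈ box d ⌈R/δ⌉} ⟨σₓ⟩⁺_{box d (L δ); β(δ), 0} ≤ ε` (packing
`pow_mul_sum_box_plusMagnetization_le` with `k` translates per axis inside the plateau of the bump
`χ_T`, `T = (k+1)(2R+3)`; the bounds `𝔪_δ(χ_T)² ≤ 80(∫ω(χ_T)² dμ + 1) ≤ 80(K₁T^{d+2} + 1)` of
sections D and E; `d ≥ 3` makes `k^{d+2}/k^{2d} ≤ 1/k`). [folklore] -/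
theorem eventually_near_plusMagnetization_le (hd : 3 ≤ d) {β ρ : ℝ → ℝ} {L : ℝ → ℕ}
    {μ : Measure (FieldConfig (EuclideanSpace ℝ (Fin d)))}
    (hβ : ∀ δ, 0 ≤ β δ) (hL : Tendsto (fun δ : ℝ => δ * L δ) (𝓝[>] 0) atTop)
    (hlim : TendstoInLaw (fun δ => isingFieldLaw d (β δ) L δ ρ) (𝓝[>] 0) μ)
    (hS : HasBoundedNondegenerateTwoPoint μ) {R : ℝ} (hR : 0 < R) {ε : ℝ} (hε : 0 < ε) :
    ∀ᶠ δ in 𝓝[>] (0 : ℝ), |ρ δ| * δ ^ d * ∑ x ∈ box d ⌈R / δ⌉₊,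
        isingExpect (zdGraph d) (box d (L δ)) (β δ) 0 .plus (spinAt x) ≤ ε := by
  obtain ⟨K₁, hK₁0, hK₁⟩ := exists_integral_sq_eval_bumpDilate_le hd hS
  -- constants: `c = 2R+3`, `Acst`, the number of translates per axis `k`, the plateau side `T`
  set c : ℝ := 2 * R + 3 with hc
  have hc3 : 3 ≤ c := by rw [hc]; linarith
  set Acst : ℝ := 80 * (K₁ + 1) * (2 * c) ^ (d + 2) with hAcst
  have hAcst0 : 0 ≤ Acst := by positivity
  set k : ℕ := ⌈Acst / ε ^ 2⌉₊ + 1 with hk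
  have hk1 : 1 ≤ k := by omega
  have hk1r : (1 : ℝ) ≤ k := by exact_mod_cast hk1
  have hkA : Acst / ε ^ 2 ≤ k := by
    rw [hk]; push_cast
    exact (Nat.le_ceil _).trans (by linarith)
  set T : ℝ := ((k : ℝ) + 1) * c with hT
  have hT1 : 1 ≤ T := by rw [hT]; nlinarith
  have hT0 : T ≠ 0 := by positivity
  have hTpos : 0 < T := by positivity
  -- the bump of side `T`, the bounds of sections D and E
  have hsD := eventually_sq_plusMagnetization_le_of_tendstoInLaw hβ hlim hS.1
    (g := bumpDilateSchwartz (d := d) hT0) (fun y => bumpDilate_nonneg T y)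
  have hsE : ∫ ω, (ω (bumpDilateSchwartz (d := d) hT0)) ^ 2 ∂μ ≤ K₁ * T ^ (d + 2) := hK₁ T hT1
  have hevL : ∀ᶠ δ in 𝓝[>] (0 : ℝ), T + 1 ≤ δ * L δ := hL.eventually_ge_atTop _
  have hδpos : ∀ᶠ δ in 𝓝[>] (0 : ℝ), 0 < δ := eventually_mem_nhdsWithin
  have hδle : ∀ᶠ δ in 𝓝[>] (0 : ℝ), δ ≤ 1 :=
    (eventually_le_nhds one_pos).filter_mono nhdsWithin_le_nhds
  filter_upwards [hsD, hevL, hδpos, hδle] with δ h1 h2 hδ hδ1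
  -- lattice data for this `δ`
  set n : ℕ := ⌈R / δ⌉₊ with hn
  set Lδ : ℕ := L δ with hLδ
  set N : ℕ := (k + 1) * (2 * n + 1) with hN
  have hδn : δ * n ≤ R + δ := by
    have hlt : (n : ℝ) < R / δ + 1 := Nat.ceil_lt_add_one (by positivity)
    have : δ * n ≤ δ * (R / δ + 1) := mul_le_mul_of_nonneg_left hlt.le hδ.le
    rwa [mul_add, mul_div_cancel₀ _ hδ.ne', mul_one] at this
  have hδN : δ * N ≤ T := by
    rw [hN, hT]; push_cast
    have : δ * ((k + 1) * (2 * n + 1)) = (k + 1) * (2 * (δ * n) + δ) := by ring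
    rw [this]
    refine mul_le_mul_of_nonneg_left ?_ (by positivity)
    rw [hc]; linarith
  have hNL : N ≤ Lδ := by
    have h' : (N : ℝ) < Lδ := by
      by_contra hcon
      push Not at hcon
      have : δ * Lδ ≤ δ * N := mul_le_mul_of_nonneg_left hcon hδ.le
      linarith
    exact_mod_cast h'.le
  -- the weight `w(y) = χ_T(δy)`: nonnegative, `= 1` on `box d N`
  set w : Site d → ℝ := fun y => bumpDilate T (δ • siteToE y) with hw
  have hw0 : ∀ y ∈ box d Lδ, 0 ≤ w y := fun y _ => bumpDilate_nonneg T _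
  have hw1 : ∀ y ∈ box d N, w y = 1 := by
    intro y hy
    refine bumpDilate_eq_one_of_forall_abs_le hTpos fun i => ?_
    rw [PiLp.smul_apply, siteToE_apply, smul_eq_mul, abs_mul, abs_of_pos hδ]
    have hyi : |(y i : ℝ)| ≤ N := by
      obtain ⟨hy1, hy2⟩ := mem_box.1 hy i
      rw [abs_le]
      exact ⟨by exact_mod_cast hy1, by exact_mod_cast hy2⟩
    calc δ * |(y i : ℝ)| ≤ δ * N := mul_le_mul_of_nonneg_left hyi hδ.le
      _ ≤ T := hδN
  -- packing
  have hpack := pow_mul_sum_box_plusMagnetization_le (d := d) (hβ δ) le_rfl hNL hw0 hw1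
  -- the functional `𝔪_δ(χ_T)` and its bound
  set X : ℝ := |ρ δ| * δ ^ d * ∑ x ∈ box d n,
    isingExpect (zdGraph d) (box d Lδ) (β δ) 0 .plus (spinAt x) with hX
  set M : ℝ := ∑ y ∈ box d Lδ, |ρ δ| * δ ^ d * bumpDilateSchwartz (d := d) hT0 (δ • siteToE y) *
    isingExpect (zdGraph d) (box d Lδ) (β δ) 0 .plus (spinAt y) with hM
  have hX0 : 0 ≤ X := by
    refine mul_nonneg (by positivity) (Finset.sum_nonneg fun x hx => ?_)
    have hnN : n ≤ N := by
      rw [hN]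
      calc n ≤ 2 * n + 1 := by omega
        _ = 1 * (2 * n + 1) := (one_mul _).symm
        _ ≤ (k + 1) * (2 * n + 1) := Nat.mul_le_mul_right _ (by omega)
    exact isingExpect_plus_spinAt_nonneg (hβ δ) (box_mono d (hnN.trans hNL) hx)
  have hXM : (k : ℝ) ^ d * X ≤ M := by
    have hM' : M = |ρ δ| * δ ^ d * ∑ y ∈ box d Lδ, w y *
        isingExpect (zdGraph d) (box d Lδ) (β δ) 0 .plus (spinAt y) := by
      rw [hM, Finset.mul_sum]
      refine Finset.sum_congr rfl fun y _ => ?_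
      simp only [hw, bumpDilateSchwartz_apply]
      ring
    rw [hM', hX]
    calc (k : ℝ) ^ d * (|ρ δ| * δ ^ d * ∑ x ∈ box d n,
          isingExpect (zdGraph d) (box d Lδ) (β δ) 0 .plus (spinAt x))
        = |ρ δ| * δ ^ d * ((k : ℝ) ^ d * ∑ x ∈ box d n,
            isingExpect (zdGraph d) (box d Lδ) (β δ) 0 .plus (spinAt x)) := by ring
      _ ≤ _ := mul_le_mul_of_nonneg_left hpack (by positivity)
  have hM2 : M ^ 2 ≤ Acst * (k : ℝ) ^ (d + 2) := by
    calc M ^ 2 ≤ 80 * (∫ ω, (ω (bumpDilateSchwartz (d := d) hT0)) ^ 2 ∂μ + 1) := h1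
      _ ≤ 80 * (K₁ * T ^ (d + 2) + 1) := by gcongr
      _ ≤ 80 * ((K₁ + 1) * T ^ (d + 2)) := by
          have : (1 : ℝ) ≤ T ^ (d + 2) := one_le_pow₀ hT1
          nlinarith
      _ ≤ 80 * ((K₁ + 1) * ((2 * c) ^ (d + 2) * (k : ℝ) ^ (d + 2))) := by
          have hTle : T ≤ 2 * c * k := by rw [hT]; nlinarith
          have : T ^ (d + 2) ≤ (2 * c) ^ (d + 2) * (k : ℝ) ^ (d + 2) :=
            calc T ^ (d + 2) ≤ (2 * c * k) ^ (d + 2) := pow_le_pow_left₀ hTpos.le hTle _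
              _ = (2 * c) ^ (d + 2) * (k : ℝ) ^ (d + 2) := mul_pow _ _ _
          gcongr
      _ = Acst * (k : ℝ) ^ (d + 2) := by rw [hAcst]; ring
  -- conclude: `X² k^{2d} ≤ Acst k^{d+2}`, `k^{d+2} k ≤ k^{2d}`, `Acst ≤ ε² k`
  have hkpos : (0 : ℝ) < k := by positivity
  have hX2 : X ^ 2 * (k : ℝ) ^ (2 * d) ≤ Acst * (k : ℝ) ^ (d + 2) := by
    have : ((k : ℝ) ^ d * X) ^ 2 ≤ M ^ 2 := pow_le_pow_left₀ (by positivity) hXM 2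
    calc X ^ 2 * (k : ℝ) ^ (2 * d) = ((k : ℝ) ^ d * X) ^ 2 := by ring
      _ ≤ M ^ 2 := this
      _ ≤ _ := hM2
  have hkpow : (k : ℝ) ^ (d + 2) * k ≤ (k : ℝ) ^ (2 * d) := by
    have : (k : ℝ) ^ (d + 2) * k = (k : ℝ) ^ (d + 3) := by ring
    rw [this]
    exact pow_le_pow_right₀ hk1r (by omega)
  have hAε : Acst ≤ ε ^ 2 * k := by
    rw [div_le_iff₀ (by positivity)] at hkA
    linarith
  have hX2ε : X ^ 2 ≤ ε ^ 2 := by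
    -- `X² k^{2d} ≤ Acst k^{d+2} ≤ ε² k · k^{d+2} ≤ ε² k^{2d}`
    have h3 : X ^ 2 * (k : ℝ) ^ (2 * d) ≤ ε ^ 2 * (k : ℝ) ^ (2 * d) :=
      calc X ^ 2 * (k : ℝ) ^ (2 * d) ≤ Acst * (k : ℝ) ^ (d + 2) := hX2
        _ ≤ ε ^ 2 * k * (k : ℝ) ^ (d + 2) := mul_le_mul_of_nonneg_right hAε (by positivity)
        _ = ε ^ 2 * ((k : ℝ) ^ (d + 2) * k) := by ring
        _ ≤ ε ^ 2 * (k : ℝ) ^ (2 * d) := mul_le_mul_of_nonneg_left hkpow (by positivity)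
    exact le_of_mul_le_mul_right h3 (by positivity)
  exact (pow_le_pow_iff_left₀ hX0 hε.le two_ne_zero).1 hX2ε

end NearRegion

/-! ### G. A soft Schwartz majorant: every Schwartz function is `o(G)` for some Schwartz `G ≥ 0`

For `f ∈ 𝒮(ℝᵈ)` put `s_j = sup_{‖z‖ ≥ 2ʲ} |f(z)|` (rapidly decreasing in `2ʲ`), `a_j = √s_j`, and
`G = ∑ⱼ a_j χ(·/2ʲ)` for a bump `χ` equal to `1` on `B(0,2)` and supported in `B(0,3)`: on the
dyadic shell `2ᴶ ≤ ‖y‖ < 2ᴶ⁺¹` only the term `j = J-1` and the constant tail `∑_{j ≥ J} a_j`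
survive, so `G` is smooth with Schwartz decay, while `G(y) ≥ a_J ≥ √|f(y)|` there, whence
`|f(y)| ≤ √|f(y)| · G(y)` with `√|f(y)| → 0`. This is the device by which convergence in law at
the single test function `G` controls the smeared magnetisation against `|f|` uniformly over all
distant regions (section H). -/

section Majorant

open Metric Set

variable {d : ℕ}

/-- The supremum of `|f|` outside the ball of radius `2ʲ`. [folklore] -/
private def tailSup (f : 𝓢(EuclideanSpace ℝ (Fin d), ℝ)) (j : ℕ) : ℝ :=
  sSup ((fun z => |f z|) '' {z : EuclideanSpace ℝ (Fin d) | (2 : ℝ) ^ j ≤ ‖z‖})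

/-- The set of values `|f(z)|`, `‖z‖ ≥ 2ʲ`, is bounded above (by `sup |f|`). [folklore] -/
private theorem bddAbove_tailSet (f : 𝓢(EuclideanSpace ℝ (Fin d), ℝ)) (j : ℕ) :
    BddAbove ((fun z => |f z|) '' {z : EuclideanSpace ℝ (Fin d) | (2 : ℝ) ^ j ≤ ‖z‖}) := by
  refine ⟨SchwartzMap.seminorm ℝ 0 0 f, ?_⟩
  rintro _ ⟨z, _, rfl⟩
  have h := SchwartzMap.le_seminorm ℝ 0 0 f z
  rwa [pow_zero, one_mul, norm_iteratedFDeriv_zero, Real.norm_eq_abs] at h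

/-- `tailSup f j ≥ 0`. [folklore] -/
private theorem tailSup_nonneg (f : 𝓢(EuclideanSpace ℝ (Fin d), ℝ)) (j : ℕ) : 0 ≤ tailSup f j :=
  Real.sSup_nonneg (by rintro _ ⟨z, _, rfl⟩; exact abs_nonneg _)

/-- `|f(z)| ≤ tailSup f j` for `‖z‖ ≥ 2ʲ`. [folklore] -/
private theorem abs_le_tailSup (f : 𝓢(EuclideanSpace ℝ (Fin d), ℝ)) {j : ℕ} {z : EuclideanSpace ℝ (Fin d)}
    (hz : (2 : ℝ) ^ j ≤ ‖z‖) : |f z| ≤ tailSup f j :=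
  le_csSup (bddAbove_tailSet f j) ⟨z, hz, rfl⟩

/-- **Schwartz decay of the tail suprema**: `tailSup f j · (2ʲ)ᴺ ≤ p_{N,0}(f)`. [folklore] -/
private theorem tailSup_mul_pow_le (f : 𝓢(EuclideanSpace ℝ (Fin d), ℝ)) (j N : ℕ) :
    tailSup f j * ((2 : ℝ) ^ j) ^ N ≤ SchwartzMap.seminorm ℝ N 0 f := by
  have h2j : (0 : ℝ) < (2 : ℝ) ^ j := by positivity
  rcases (((fun z => |f z|) '' {z : EuclideanSpace ℝ (Fin d) | (2 : ℝ) ^ j ≤ ‖z‖})).eq_empty_or_nonempty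
    with hE | hE
  · rw [tailSup, hE, Real.sSup_empty, zero_mul]
    exact apply_nonneg _ _
  · rw [← le_div_iff₀ (by positivity), tailSup]
    refine csSup_le hE ?_
    rintro _ ⟨z, hz, rfl⟩
    have hz' : (2 : ℝ) ^ j ≤ ‖z‖ := hz
    have hzpos : 0 < ‖z‖ := h2j.trans_le hz'
    rw [le_div_iff₀ (by positivity)]
    have h := SchwartzMap.le_seminorm ℝ N 0 f z
    rw [norm_iteratedFDeriv_zero, Real.norm_eq_abs] at h
    calc |f z| * ((2 : ℝ) ^ j) ^ N ≤ |f z| * ‖z‖ ^ N :=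
          mul_le_mul_of_nonneg_left (pow_le_pow_left₀ h2j.le hz' N) (abs_nonneg _)
      _ = ‖z‖ ^ N * |f z| := mul_comm _ _
      _ ≤ SchwartzMap.seminorm ℝ N 0 f := h

/-- The coefficients `a_j = √(tailSup f j)`. [folklore] -/
private def majCoeff (f : 𝓢(EuclideanSpace ℝ (Fin d), ℝ)) (j : ℕ) : ℝ := Real.sqrt (tailSup f j)

/-- `a_j ≥ 0`. [folklore] -/
private theorem majCoeff_nonneg (f : 𝓢(EuclideanSpace ℝ (Fin d), ℝ)) (j : ℕ) : 0 ≤ majCoeff f j :=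
  Real.sqrt_nonneg _

/-- The constants `q_N = √p_{2N,0}(f)`. [folklore] -/
private def majConst (f : 𝓢(EuclideanSpace ℝ (Fin d), ℝ)) (N : ℕ) : ℝ := Real.sqrt (SchwartzMap.seminorm ℝ (2 * N) 0 f)

/-- `q_N ≥ 0`. [folklore] -/
private theorem majConst_nonneg (f : 𝓢(EuclideanSpace ℝ (Fin d), ℝ)) (N : ℕ) : 0 ≤ majConst f N :=
  Real.sqrt_nonneg _

/-- **Rapid decay of the coefficients**: `a_j (2ʲ)ᴺ ≤ q_N`. [folklore] -/
private theorem majCoeff_mul_pow_le (f : 𝓢(EuclideanSpace ℝ (Fin d), ℝ)) (j N : ℕ) :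
    majCoeff f j * ((2 : ℝ) ^ j) ^ N ≤ majConst f N := by
  rw [majCoeff, majConst]
  have hsq : (Real.sqrt (tailSup f j) * ((2 : ℝ) ^ j) ^ N) ^ 2 ≤ SchwartzMap.seminorm ℝ (2 * N) 0 f := by
    rw [mul_pow, Real.sq_sqrt (tailSup_nonneg f j), ← pow_mul, mul_comm N 2]
    exact tailSup_mul_pow_le f j (2 * N)
  have h := Real.abs_le_sqrt hsq
  rwa [abs_of_nonneg (mul_nonneg (Real.sqrt_nonneg _) (by positivity))] at h

/-- `a_j ≤ q₁ (1/2)ʲ`. [folklore] -/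
private theorem majCoeff_le_geom (f : 𝓢(EuclideanSpace ℝ (Fin d), ℝ)) (j : ℕ) :
    majCoeff f j ≤ majConst f 1 * (1 / 2 : ℝ) ^ j := by
  have h := majCoeff_mul_pow_le f j 1
  rw [pow_one] at h
  have h2 : (0 : ℝ) < (2 : ℝ) ^ j := by positivity
  rw [one_div, inv_pow, ← div_eq_mul_inv, le_div_iff₀ h2]
  exact h

/-- The coefficients are summable. [folklore] -/
private theorem summable_majCoeff (f : 𝓢(EuclideanSpace ℝ (Fin d), ℝ)) : Summable (majCoeff f) :=
  Summable.of_nonneg_of_le (majCoeff_nonneg f) (majCoeff_le_geom f)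
    ((summable_geometric_of_lt_one (by norm_num) (by norm_num)).mul_left _)

/-- The bump `χ`: `1` on `B(0,2)`, supported in `B(0,3)`. [folklore] -/
private def majBump (d : ℕ) : ContDiffBump (0 : EuclideanSpace ℝ (Fin d)) := ⟨2, 3, by norm_num, by norm_num⟩

/-- The dyadic dilates `χ_j(y) = χ(y/2ʲ)`. [folklore] -/
private def majTerm (d : ℕ) (j : ℕ) (y : EuclideanSpace ℝ (Fin d)) : ℝ := majBump d (((2 : ℝ) ^ j)⁻¹ • y)

/-- `0 ≤ χ_j ≤ 1`. [folklore] -/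
private theorem majTerm_nonneg (j : ℕ) (y : EuclideanSpace ℝ (Fin d)) : 0 ≤ majTerm d j y := (majBump d).nonneg

/-- `χ_j ≤ 1`. [folklore] -/
private theorem majTerm_le_one (j : ℕ) (y : EuclideanSpace ℝ (Fin d)) : majTerm d j y ≤ 1 := (majBump d).le_one

/-- `χ_j(y) = 1` for `‖y‖ ≤ 2ʲ⁺¹`. [folklore] -/
private theorem majTerm_eq_one {j : ℕ} {y : EuclideanSpace ℝ (Fin d)} (hy : ‖y‖ ≤ (2 : ℝ) ^ (j + 1)) :
    majTerm d j y = 1 := by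
  unfold majTerm
  refine (majBump d).one_of_mem_closedBall ?_
  have h2 : (0 : ℝ) < (2 : ℝ) ^ j := by positivity
  rw [mem_closedBall, dist_zero_right, norm_smul, norm_inv, Real.norm_eq_abs, abs_of_pos h2]
  change ((2 : ℝ) ^ j)⁻¹ * ‖y‖ ≤ 2
  rw [inv_mul_le_iff₀ h2, pow_succ] at *
  linarith

/-- `χ_j(y') = 0` for `‖y'‖ > 3 · 2ʲ`, hence `χ_j` vanishes near any such point. [folklore] -/
private theorem majTerm_eventuallyEq_zero {j : ℕ} {y : EuclideanSpace ℝ (Fin d)} (hy : 3 * (2 : ℝ) ^ j < ‖y‖) :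
    (majTerm d j) =ᶠ[𝓝 y] fun _ => 0 := by
  have h2 : (0 : ℝ) < (2 : ℝ) ^ j := by positivity
  have hopen : IsOpen {y' : EuclideanSpace ℝ (Fin d) | 3 * (2 : ℝ) ^ j < ‖y'‖} :=
    isOpen_lt continuous_const continuous_norm
  filter_upwards [hopen.mem_nhds hy] with y' hy'
  unfold majTerm
  refine (majBump d).zero_of_le_dist ?_
  rw [dist_zero_right, norm_smul, norm_inv, Real.norm_eq_abs, abs_of_pos h2]
  change (3 : ℝ) ≤ ((2 : ℝ) ^ j)⁻¹ * ‖y'‖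
  rw [le_inv_mul_iff₀ h2]
  have hy'' : 3 * (2 : ℝ) ^ j < ‖y'‖ := hy'
  linarith

/-- `χ_j` is smooth. [folklore] -/
private theorem contDiff_majTerm (j : ℕ) {n : ℕ∞} : ContDiff ℝ n (majTerm d j) :=
  (majBump d).contDiff.comp (contDiff_const_smul _)

/-- `χ` as a Schwartz function (for its derivative bounds). [folklore] -/
private def majBumpSchwartz (d : ℕ) : 𝓢(EuclideanSpace ℝ (Fin d), ℝ) :=
  (majBump d).hasCompactSupport.toSchwartzMap (majBump d).contDiff

/-- **Uniform derivative bounds for the dilates**: `‖Dⁿχ_j(y)‖ ≤ p_{0,n}(χ)` (the dilation factor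
`2⁻ʲ ≤ 1` only helps). [folklore] -/
private theorem norm_iteratedFDeriv_majTerm_le (j n : ℕ) (y : EuclideanSpace ℝ (Fin d)) :
    ‖iteratedFDeriv ℝ n (majTerm d j) y‖ ≤ SchwartzMap.seminorm ℝ 0 n (majBumpSchwartz d) := by
  set L : EuclideanSpace ℝ (Fin d) →L[ℝ] EuclideanSpace ℝ (Fin d) :=
    ((2 : ℝ) ^ j)⁻¹ • ContinuousLinearMap.id ℝ _ with hL
  have hcomp : majTerm d j = (majBump d) ∘ L := by
    funext y'; simp [majTerm, hL]
  have h2 : (0 : ℝ) < (2 : ℝ) ^ j := by positivity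
  have hLnorm : ‖L‖ ≤ 1 := by
    refine ContinuousLinearMap.opNorm_le_bound _ zero_le_one fun y' => ?_
    have hLy : L y' = ((2 : ℝ) ^ j)⁻¹ • y' := by simp [hL]
    rw [hLy, norm_smul, norm_inv, Real.norm_eq_abs, abs_of_pos h2, one_mul]
    exact mul_le_of_le_one_left (norm_nonneg _) (inv_le_one_of_one_le₀ (one_le_pow₀ (by norm_num)))
  rw [hcomp, L.iteratedFDeriv_comp_right ((majBump d).contDiff (n := n)) y (i := n) le_rfl]
  refine (ContinuousMultilinearMap.norm_compContinuousLinearMap_le _ _).trans ?_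
  have hprod : ∏ _i : Fin n, ‖L‖ ≤ 1 := Finset.prod_le_one (fun _ _ => norm_nonneg _) fun _ _ => hLnorm
  calc ‖iteratedFDeriv ℝ n (⇑(majBump d)) (L y)‖ * ∏ _i : Fin n, ‖L‖
      ≤ SchwartzMap.seminorm ℝ 0 n (majBumpSchwartz d) * 1 :=
        mul_le_mul (SchwartzMap.norm_iteratedFDeriv_le_seminorm ℝ (majBumpSchwartz d) n (L y))
          hprod (Finset.prod_nonneg fun _ _ => norm_nonneg _) (apply_nonneg _ _)
    _ = _ := mul_one _

/-- `Dⁿχ_j(y) = 0` for `‖y‖ > 3 · 2ʲ`. [folklore] -/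
private theorem iteratedFDeriv_majTerm_eq_zero {j : ℕ} {y : EuclideanSpace ℝ (Fin d)}
    (hy : 3 * (2 : ℝ) ^ j < ‖y‖) (n : ℕ) : iteratedFDeriv ℝ n (majTerm d j) y = 0 := by
  have h := (majTerm_eventuallyEq_zero (d := d) hy).iteratedFDeriv (𝕜 := ℝ) n
  rw [h.eq_of_nhds, iteratedFDeriv_fun_zero]
  rfl

/-- The majorant as a function: `G(y) = ∑ⱼ a_j χ_j(y)`. [folklore] -/
private def majFun (f : 𝓢(EuclideanSpace ℝ (Fin d), ℝ)) (y : EuclideanSpace ℝ (Fin d)) : ℝ :=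
  ∑' j, majCoeff f j * majTerm d j y

/-- The series defining `G(y)` converges absolutely (terms `≤ a_j`). [folklore] -/
private theorem summable_majFun_terms (f : 𝓢(EuclideanSpace ℝ (Fin d), ℝ)) (y : EuclideanSpace ℝ (Fin d)) :
    Summable fun j => majCoeff f j * majTerm d j y :=
  Summable.of_nonneg_of_le (fun j => mul_nonneg (majCoeff_nonneg f j) (majTerm_nonneg j y))
    (fun j => mul_le_of_le_one_right (majCoeff_nonneg f j) (majTerm_le_one j y)) (summable_majCoeff f)

/-- The tails `t_J = ∑_{j ≥ J} a_j`. [folklore] -/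
private def majTail (f : 𝓢(EuclideanSpace ℝ (Fin d), ℝ)) (J : ℕ) : ℝ := ∑' j, majCoeff f (j + J)

/-- `t_J ≥ 0`. [folklore] -/
private theorem majTail_nonneg (f : 𝓢(EuclideanSpace ℝ (Fin d), ℝ)) (J : ℕ) : 0 ≤ majTail f J :=
  tsum_nonneg fun _ => majCoeff_nonneg f _

/-- **Local representation**: on the ball `‖y‖ < 2ᴶ⁺¹`,
`G(y) = ∑_{j < J} a_j χ_j(y) + t_J` (the terms `j ≥ J` are `≡ a_j` there). [folklore] -/
private theorem majFun_eq_of_norm_lt (f : 𝓢(EuclideanSpace ℝ (Fin d), ℝ)) {J : ℕ} {y : EuclideanSpace ℝ (Fin d)}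
    (hy : ‖y‖ < (2 : ℝ) ^ (J + 1)) :
    majFun f y = (∑ j ∈ Finset.range J, majCoeff f j * majTerm d j y) + majTail f J := by
  rw [majFun, ← (summable_majFun_terms f y).sum_add_tsum_nat_add J, majTail]
  congr 1
  refine tsum_congr fun j => ?_
  rw [majTerm_eq_one, mul_one]
  refine hy.le.trans (pow_le_pow_right₀ (by norm_num) (by omega))

/-- The local representative `F_J`. [folklore] -/
private def majLocal (f : 𝓢(EuclideanSpace ℝ (Fin d), ℝ)) (J : ℕ) (y : EuclideanSpace ℝ (Fin d)) : ℝ :=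
  (∑ j ∈ Finset.range J, majCoeff f j * majTerm d j y) + majTail f J

/-- Unfolding `F_J`. [folklore] -/
private theorem majLocal_def (f : 𝓢(EuclideanSpace ℝ (Fin d), ℝ)) (J : ℕ) :
    majLocal f J = fun y => (∑ j ∈ Finset.range J, majCoeff f j * majTerm d j y) + majTail f J := rfl

/-- `F_J` is smooth. [folklore] -/
private theorem contDiff_majLocal (f : 𝓢(EuclideanSpace ℝ (Fin d), ℝ)) (J : ℕ) {n : ℕ∞} :
    ContDiff ℝ n (majLocal f J) :=
  (ContDiff.sum fun j _ => contDiff_const.mul (contDiff_majTerm j)).add contDiff_const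

/-- `G = F_J` near every point of the ball `‖y‖ < 2ᴶ⁺¹`. [folklore] -/
private theorem majFun_eventuallyEq_majLocal (f : 𝓢(EuclideanSpace ℝ (Fin d), ℝ)) {J : ℕ}
    {y : EuclideanSpace ℝ (Fin d)} (hy : ‖y‖ < (2 : ℝ) ^ (J + 1)) :
    majFun f =ᶠ[𝓝 y] majLocal f J := by
  have hopen : IsOpen {y' : EuclideanSpace ℝ (Fin d) | ‖y'‖ < (2 : ℝ) ^ (J + 1)} :=
    isOpen_lt continuous_norm continuous_const
  filter_upwards [hopen.mem_nhds hy] with y' hy'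
  exact majFun_eq_of_norm_lt f hy'

/-- Every point lies in some dyadic ball. [folklore] -/
theorem exists_norm_lt_two_pow (y : EuclideanSpace ℝ (Fin d)) : ∃ J : ℕ, ‖y‖ < (2 : ℝ) ^ (J + 1) := by
  obtain ⟨J, hJ⟩ := exists_nat_gt ‖y‖
  refine ⟨J, hJ.trans ?_⟩
  have h : (J : ℝ) < (2 : ℝ) ^ J := by exact_mod_cast Nat.lt_two_pow_self
  exact h.trans_le (pow_le_pow_right₀ (by norm_num) (by omega))

/-- **`G` is smooth.** [folklore] -/
private theorem contDiff_majFun (f : 𝓢(EuclideanSpace ℝ (Fin d), ℝ)) : ContDiff ℝ (⊤ : ℕ∞) (majFun f) := by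
  refine contDiff_iff_contDiffAt.2 fun y => ?_
  obtain ⟨J, hJ⟩ := exists_norm_lt_two_pow y
  exact (contDiff_majLocal f J).contDiffAt.congr_of_eventuallyEq (majFun_eventuallyEq_majLocal f hJ)

/-- The derivatives of a constant are bounded by its size. [folklore] -/
theorem norm_iteratedFDeriv_const_le {c : ℝ} (n : ℕ) (y : EuclideanSpace ℝ (Fin d)) :
    ‖iteratedFDeriv ℝ n (fun _ : EuclideanSpace ℝ (Fin d) => c) y‖ ≤ |c| := by
  rcases Nat.eq_zero_or_pos n with rfl | hn
  · rw [norm_iteratedFDeriv_zero, Real.norm_eq_abs]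
  · rw [iteratedFDeriv_const_of_ne (by omega)]
    simp

/-- **Derivatives of `G` on the dyadic shell `2ᴶ ≤ ‖y‖ < 2ᴶ⁺¹` (`J ≥ 1`)**: only `j = J - 1`
and the constant tail contribute, `‖DⁿG(y)‖ ≤ a_{J-1} p_{0,n}(χ) + t_J`. [folklore] -/
private theorem norm_iteratedFDeriv_majFun_le_shell (f : 𝓢(EuclideanSpace ℝ (Fin d), ℝ)) {J : ℕ} (hJ : 1 ≤ J)
    {y : EuclideanSpace ℝ (Fin d)} (hy1 : (2 : ℝ) ^ J ≤ ‖y‖) (hy2 : ‖y‖ < (2 : ℝ) ^ (J + 1)) (n : ℕ) :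
    ‖iteratedFDeriv ℝ n (majFun f) y‖ ≤
      majCoeff f (J - 1) * SchwartzMap.seminorm ℝ 0 n (majBumpSchwartz d) + majTail f J := by
  have hrep := ((majFun_eventuallyEq_majLocal f hy2).iteratedFDeriv (𝕜 := ℝ) n).eq_of_nhds
  rw [hrep, majLocal_def]
  have hS : ContDiff ℝ n (fun y' => ∑ j ∈ Finset.range J, majCoeff f j * majTerm d j y') :=
    ContDiff.sum fun j _ => contDiff_const.mul (contDiff_majTerm j)
  have hadd := iteratedFDeriv_add_apply (𝕜 := ℝ) (i := n) (x := y)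
    (f := fun y' => ∑ j ∈ Finset.range J, majCoeff f j * majTerm d j y')
    (g := fun _ => majTail f J) hS.contDiffAt contDiff_const.contDiffAt
  rw [show (fun y' => (∑ j ∈ Finset.range J, majCoeff f j * majTerm d j y') + majTail f J) =
      (fun y' => ∑ j ∈ Finset.range J, majCoeff f j * majTerm d j y') + (fun _ => majTail f J) from rfl,
    hadd]
  refine (norm_add_le _ _).trans (add_le_add ?_ ((norm_iteratedFDeriv_const_le n y).trans
    (le_of_eq (abs_of_nonneg (majTail_nonneg f J)))))
  -- the finite sum: only `j = J - 1` survives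
  have hterm : ∀ j, (fun y' => majCoeff f j * majTerm d j y') = majCoeff f j • majTerm d j := by
    intro j; funext y'; simp [smul_eq_mul]
  rw [show (fun y' => ∑ j ∈ Finset.range J, majCoeff f j * majTerm d j y') =
      (fun y' => ∑ j ∈ Finset.range J, (majCoeff f j • majTerm d j) y') by
        funext y'; simp [smul_eq_mul],
    iteratedFDeriv_sum (fun j _ => (show ContDiff ℝ (n : ℕ∞) (majCoeff f j • majTerm d j) from
      (contDiff_majTerm j).const_smul (majCoeff f j))), Finset.sum_apply]
  have hsplit : Finset.range J = insert (J - 1) (Finset.range (J - 1)) := by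
    rw [← Finset.range_add_one]; congr 1; omega
  rw [hsplit, Finset.sum_insert (by simp)]
  have hzero : ∀ j ∈ Finset.range (J - 1), iteratedFDeriv ℝ n (majCoeff f j • majTerm d j) y = 0 := by
    intro j hj
    rw [Finset.mem_range] at hj
    rw [iteratedFDeriv_const_smul_apply (contDiff_majTerm j).contDiffAt, iteratedFDeriv_majTerm_eq_zero]
    · simp
    · -- `3 · 2ʲ ≤ 3 · 2^{J-2} < 2ᴶ ≤ ‖y‖`
      have hj2 : j + 2 ≤ J := by omega
      calc 3 * (2 : ℝ) ^ j < 4 * (2 : ℝ) ^ j := by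
            have : (0 : ℝ) < (2 : ℝ) ^ j := by positivity
            linarith
        _ = (2 : ℝ) ^ (j + 2) := by ring
        _ ≤ (2 : ℝ) ^ J := pow_le_pow_right₀ (by norm_num) hj2
        _ ≤ ‖y‖ := hy1
  rw [Finset.sum_eq_zero hzero, add_zero, iteratedFDeriv_const_smul_apply (contDiff_majTerm _).contDiffAt,
    norm_smul, Real.norm_eq_abs, abs_of_nonneg (majCoeff_nonneg f _)]
  exact mul_le_mul_of_nonneg_left (norm_iteratedFDeriv_majTerm_le _ n y) (majCoeff_nonneg f _)

/-- Near the origin (`‖y‖ < 2`) the majorant is the constant `t₀`. [folklore] -/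
private theorem norm_iteratedFDeriv_majFun_le_small (f : 𝓢(EuclideanSpace ℝ (Fin d), ℝ)) {y : EuclideanSpace ℝ (Fin d)}
    (hy : ‖y‖ < 2) (n : ℕ) : ‖iteratedFDeriv ℝ n (majFun f) y‖ ≤ majTail f 0 := by
  have hy' : ‖y‖ < (2 : ℝ) ^ (0 + 1) := by simpa using hy
  have hrep := ((majFun_eventuallyEq_majLocal f hy').iteratedFDeriv (𝕜 := ℝ) n).eq_of_nhds
  rw [hrep]
  have : majLocal f 0 = fun _ => majTail f 0 := by funext y'; simp [majLocal]
  rw [this]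
  exact (norm_iteratedFDeriv_const_le n y).trans (le_of_eq (abs_of_nonneg (majTail_nonneg f 0)))

/-- **Tail bound**: `t_J (2ᴶ)ᵏ ≤ 2 q_{k+1}`. [folklore] -/
private theorem majTail_mul_pow_le (f : 𝓢(EuclideanSpace ℝ (Fin d), ℝ)) (J k : ℕ) :
    majTail f J * ((2 : ℝ) ^ J) ^ k ≤ 2 * majConst f (k + 1) := by
  have hgeom : Summable fun j : ℕ => majConst f (k + 1) * (1 / 2 : ℝ) ^ j :=
    (summable_geometric_of_lt_one (by norm_num) (by norm_num)).mul_left _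
  have hle : ∀ j, majCoeff f (j + J) * ((2 : ℝ) ^ J) ^ k ≤ majConst f (k + 1) * (1 / 2 : ℝ) ^ j := by
    intro j
    have h := majCoeff_mul_pow_le f (j + J) (k + 1)
    have h2j : (0 : ℝ) < (2 : ℝ) ^ j := by positivity
    have h2J : (0 : ℝ) < (2 : ℝ) ^ J := by positivity
    have h2jJ : (2 : ℝ) ^ (j + J) = (2 : ℝ) ^ j * (2 : ℝ) ^ J := pow_add _ _ _
    -- `a (2ᴶ)ᵏ ≤ a (2^{j+J})ᵏ = a (2^{j+J})^{k+1} / 2^{j+J} ≤ q / 2^{j+J} ≤ q / 2ʲ`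
    have hstep : majCoeff f (j + J) * ((2 : ℝ) ^ J) ^ k * (2 : ℝ) ^ j ≤ majConst f (k + 1) := by
      calc majCoeff f (j + J) * ((2 : ℝ) ^ J) ^ k * (2 : ℝ) ^ j
          ≤ majCoeff f (j + J) * ((2 : ℝ) ^ (j + J)) ^ k * (2 : ℝ) ^ (j + J) := by
            have ha := majCoeff_nonneg f (j + J)
            have h1 : ((2 : ℝ) ^ J) ^ k ≤ ((2 : ℝ) ^ (j + J)) ^ k :=
              pow_le_pow_left₀ h2J.le (pow_le_pow_right₀ (by norm_num) (by omega)) k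
            have h3 : (2 : ℝ) ^ j ≤ (2 : ℝ) ^ (j + J) := pow_le_pow_right₀ (by norm_num) (by omega)
            gcongr
        _ = majCoeff f (j + J) * ((2 : ℝ) ^ (j + J)) ^ (k + 1) := by ring
        _ ≤ majConst f (k + 1) := h
    rw [one_div, inv_pow, ← div_eq_mul_inv, le_div_iff₀ h2j]
    exact hstep
  have hsum : Summable fun j : ℕ => majCoeff f (j + J) * ((2 : ℝ) ^ J) ^ k :=
    Summable.of_nonneg_of_le (fun j => mul_nonneg (majCoeff_nonneg f _) (by positivity)) hle hgeom
  rw [majTail, ← tsum_mul_right]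
  calc ∑' j, majCoeff f (j + J) * ((2 : ℝ) ^ J) ^ k ≤ ∑' j : ℕ, majConst f (k + 1) * (1 / 2 : ℝ) ^ j :=
        hsum.tsum_le_tsum hle hgeom
    _ = majConst f (k + 1) * 2 := by
        rw [tsum_mul_left, tsum_geometric_of_lt_one (by norm_num) (by norm_num)]; norm_num
    _ = 2 * majConst f (k + 1) := mul_comm _ _

/-- **Schwartz decay of `G`.** [folklore] -/
private theorem majFun_decay (f : 𝓢(EuclideanSpace ℝ (Fin d), ℝ)) (k n : ℕ) :
    ∃ C : ℝ, ∀ y : EuclideanSpace ℝ (Fin d), ‖y‖ ^ k * ‖iteratedFDeriv ℝ n (majFun f) y‖ ≤ C := by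
  set Cn : ℝ := SchwartzMap.seminorm ℝ 0 n (majBumpSchwartz d) with hCn
  have hCn0 : 0 ≤ Cn := apply_nonneg _ _
  refine ⟨2 ^ k * majTail f 0 + (4 ^ k * (majConst f k * Cn) + 2 ^ k * (2 * majConst f (k + 1))), fun y => ?_⟩
  have hA0 : 0 ≤ 2 ^ k * majTail f 0 := mul_nonneg (by positivity) (majTail_nonneg f 0)
  have hB0 : 0 ≤ 4 ^ k * (majConst f k * Cn) + 2 ^ k * (2 * majConst f (k + 1)) := by
    have := majConst_nonneg f k; have := majConst_nonneg f (k + 1); positivity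
  by_cases hy : ‖y‖ < 2
  · -- near the origin `G` is constant
    have h1 := norm_iteratedFDeriv_majFun_le_small f hy n
    calc ‖y‖ ^ k * ‖iteratedFDeriv ℝ n (majFun f) y‖ ≤ 2 ^ k * majTail f 0 :=
          mul_le_mul (pow_le_pow_left₀ (norm_nonneg _) hy.le k) h1 (norm_nonneg _) (by positivity)
      _ ≤ _ := le_add_of_nonneg_right hB0
  · push Not at hy
    obtain ⟨J, hJ1, hJ2⟩ := exists_nat_pow_near (one_le_two.trans hy) one_lt_two
    have hJpos : 1 ≤ J := by
      by_contra h0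
      have : J = 0 := by omega
      subst this
      simp at hJ2
      linarith
    have h1 := norm_iteratedFDeriv_majFun_le_shell f hJpos hJ1 hJ2 n
    have hyk : ‖y‖ ^ k ≤ ((2 : ℝ) ^ (J + 1)) ^ k := pow_le_pow_left₀ (norm_nonneg _) hJ2.le k
    -- the two surviving contributions
    have hc1 : ((2 : ℝ) ^ (J + 1)) ^ k * (majCoeff f (J - 1) * Cn) ≤ 4 ^ k * (majConst f k * Cn) := by
      have h := majCoeff_mul_pow_le f (J - 1) k
      have hpow : ((2 : ℝ) ^ (J + 1)) ^ k = 4 ^ k * ((2 : ℝ) ^ (J - 1)) ^ k := by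
        rw [← mul_pow]; congr 1
        rw [show J + 1 = (J - 1) + 2 by omega, pow_add]; ring
      rw [hpow]
      calc 4 ^ k * ((2 : ℝ) ^ (J - 1)) ^ k * (majCoeff f (J - 1) * Cn)
          = 4 ^ k * ((majCoeff f (J - 1) * ((2 : ℝ) ^ (J - 1)) ^ k) * Cn) := by ring
        _ ≤ 4 ^ k * (majConst f k * Cn) := by gcongr
    have hc2 : ((2 : ℝ) ^ (J + 1)) ^ k * majTail f J ≤ 2 ^ k * (2 * majConst f (k + 1)) := by
      have h := majTail_mul_pow_le f J k
      have hpow : ((2 : ℝ) ^ (J + 1)) ^ k = 2 ^ k * ((2 : ℝ) ^ J) ^ k := by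
        rw [← mul_pow]; congr 1; rw [pow_succ]; ring
      rw [hpow]
      calc 2 ^ k * ((2 : ℝ) ^ J) ^ k * majTail f J = 2 ^ k * (majTail f J * ((2 : ℝ) ^ J) ^ k) := by ring
        _ ≤ 2 ^ k * (2 * majConst f (k + 1)) := by gcongr
    calc ‖y‖ ^ k * ‖iteratedFDeriv ℝ n (majFun f) y‖
        ≤ ((2 : ℝ) ^ (J + 1)) ^ k * (majCoeff f (J - 1) * Cn + majTail f J) :=
          mul_le_mul hyk h1 (norm_nonneg _) (by positivity)
      _ = ((2 : ℝ) ^ (J + 1)) ^ k * (majCoeff f (J - 1) * Cn) + ((2 : ℝ) ^ (J + 1)) ^ k * majTail f J := by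
          ring
      _ ≤ 4 ^ k * (majConst f k * Cn) + 2 ^ k * (2 * majConst f (k + 1)) := add_le_add hc1 hc2
      _ ≤ _ := le_add_of_nonneg_left hA0

/-- **The majorant as a Schwartz function.** [folklore] -/
private def majSchwartz (f : 𝓢(EuclideanSpace ℝ (Fin d), ℝ)) : 𝓢(EuclideanSpace ℝ (Fin d), ℝ) :=
  ⟨majFun f, contDiff_majFun f, majFun_decay f⟩

/-- The Schwartz majorant evaluates as `majFun`. [folklore] -/
@[simp] private theorem majSchwartz_apply (f : 𝓢(EuclideanSpace ℝ (Fin d), ℝ)) (y : EuclideanSpace ℝ (Fin d)) :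
    majSchwartz f y = majFun f y := rfl

/-- `G ≥ 0`. [folklore] -/
private theorem majFun_nonneg (f : 𝓢(EuclideanSpace ℝ (Fin d), ℝ)) (y : EuclideanSpace ℝ (Fin d)) : 0 ≤ majFun f y :=
  tsum_nonneg fun j => mul_nonneg (majCoeff_nonneg f j) (majTerm_nonneg j y)

/-- **Domination on dyadic shells**: `√|f(y)| ≤ G(y)` for `‖y‖ ≥ 1`. [folklore] -/
private theorem sqrt_abs_le_majFun (f : 𝓢(EuclideanSpace ℝ (Fin d), ℝ)) {y : EuclideanSpace ℝ (Fin d)}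
    (hy : 1 ≤ ‖y‖) : Real.sqrt |f y| ≤ majFun f y := by
  obtain ⟨J, hJ1, hJ2⟩ := exists_nat_pow_near hy one_lt_two
  have hterm : majCoeff f J * majTerm d J y = majCoeff f J := by
    rw [majTerm_eq_one hJ2.le, mul_one]
  calc Real.sqrt |f y| ≤ majCoeff f J := Real.sqrt_le_sqrt (abs_le_tailSup f hJ1)
    _ = majCoeff f J * majTerm d J y := hterm.symm
    _ ≤ majFun f y := (summable_majFun_terms f y).le_tsum J
        (fun j _ => mul_nonneg (majCoeff_nonneg f j) (majTerm_nonneg j y))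

/-- **Soft Schwartz majorant.** For every Schwartz function `f` on `ℝᵈ` there is a Schwartz
function `G ≥ 0` such that `|f| = o(G)` at infinity: for every `ε > 0` there is `R` with
`|f(y)| ≤ ε G(y)` whenever `‖y‖ ≥ R`. [folklore] -/
theorem exists_schwartz_soft_majorant (f : 𝓢(EuclideanSpace ℝ (Fin d), ℝ)) :
    ∃ G : 𝓢(EuclideanSpace ℝ (Fin d), ℝ), (∀ y, 0 ≤ G y) ∧
      ∀ ε : ℝ, 0 < ε → ∃ R : ℝ, ∀ y, R ≤ ‖y‖ → |f y| ≤ ε * G y := by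
  refine ⟨majSchwartz f, fun y => majFun_nonneg f y, fun ε hε => ?_⟩
  -- `tailSup f J → 0`, pick `J₀` with `tailSup f J₀ ≤ ε²`
  obtain ⟨J₀, hJ₀⟩ : ∃ J₀ : ℕ, tailSup f J₀ ≤ ε ^ 2 := by
    have hlim : Tendsto (fun J : ℕ => SchwartzMap.seminorm ℝ 1 0 f * (1 / 2 : ℝ) ^ J) atTop (𝓝 0) := by
      have h := (tendsto_pow_atTop_nhds_zero_of_lt_one (by norm_num : (0 : ℝ) ≤ 1 / 2)
        (by norm_num : (1 / 2 : ℝ) < 1)).const_mul (SchwartzMap.seminorm ℝ 1 0 f)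
      rwa [mul_zero] at h
    obtain ⟨J₀, hJ₀⟩ := ((tendsto_order.1 hlim).2 (ε ^ 2) (by positivity)).exists
    refine ⟨J₀, le_of_lt (lt_of_le_of_lt ?_ hJ₀)⟩
    have h := tailSup_mul_pow_le f J₀ 1
    rw [pow_one] at h
    have h2 : (0 : ℝ) < (2 : ℝ) ^ J₀ := by positivity
    rw [one_div, inv_pow, ← div_eq_mul_inv, le_div_iff₀ h2]
    exact h
  refine ⟨max 1 ((2 : ℝ) ^ J₀), fun y hy => ?_⟩
  have hy1 : 1 ≤ ‖y‖ := (le_max_left _ _).trans hy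
  have hy2 : (2 : ℝ) ^ J₀ ≤ ‖y‖ := (le_max_right _ _).trans hy
  have hsq : Real.sqrt |f y| ≤ ε := by
    rw [Real.sqrt_le_left hε.le]
    exact (abs_le_tailSup f hy2).trans hJ₀
  calc |f y| = Real.sqrt |f y| * Real.sqrt |f y| := (Real.mul_self_sqrt (abs_nonneg _)).symm
    _ ≤ ε * majFun f y :=
        mul_le_mul hsq (sqrt_abs_le_majFun f hy1) (Real.sqrt_nonneg _) hε.le
    _ = ε * majSchwartz f y := rfl

end Majorant

/-! ### H. Assembly: the plus-boundary magnetisation functional vanishes; crit-ising.S13 for `d ≥ 5`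

`M_δ(f) = ∑_{x ∈ box} |ρ(δ) δᵈ f(δx)| ⟨σₓ⟩⁺_{box; β(δ), 0}` splits into the near cube `‖δx‖_∞ ≤ R`
(section F) and the far region, where `|f| ≤ ε' G` for the soft majorant `G` of section G and
`𝔪_δ(G)` is eventually bounded (section D). Feeding `M_δ(f) → 0` into
`highDim_triviality_plus_of_five_le` / `highDim_triviality_plus` (`FieldScalingLimitPlusBoxProofs`)
proves the plus-box rendering of crit-ising.S13: unconditionally for `d ≥ 5`, and from the named
fact `panis_ursellFourSum_le_four` for `d ≥ 4`. -/

section Assembly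

variable {d : ℕ}

/-- **The renormalised plus-boundary magnetisation functional vanishes under the hypotheses of
`highDim_triviality`.** For `d ≥ 3`, `β(δ) ≥ 0`, boxes with `δ L(δ) → ∞`, plus-box laws converging
in law to a law `μ` with bounded non-degenerate two-point function, and every test function `f`:
`M_δ(f) = ∑_{x ∈ box d (L δ)} |ρ(δ) δᵈ f(δx)| ⟨σₓ⟩⁺_{box d (L δ); β(δ), 0} → 0` as `δ → 0⁺`. This is
the finite-size input isolated in `FieldScalingLimitPlusBoxProofs` (hypothesis `hM` of
`highDim_triviality_plus_of_five_le`), here DERIVED from the a-posteriori hypotheses: scale and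
mean pinning by Lebowitz' inequality with fields and Paley–Zygmund (sections B–D), the one-point
Messager–Miracle-Solé monotonicity and packing (sections A, F), the Riesz scaling of the limiting
two-point function (section E), and a soft Schwartz majorant for the far region (section G).
[cite: MessagerMiracleSoleJSP1977, main theorem (monotonicity of ⟨σ₀σ_x⟩ under reflections)] [cite: GlimmJaffe1987, Cor. 4.3.2 and Cor. 4.3.3] [cite: AizenmanDuminilCopinAnnals2021, Thm 1.2 (hypothesis "bounded non-degenerate two-point function"), p. 4] -/
theorem tendsto_plusBoundaryMagnetization_of_tendstoInLaw (hd : 3 ≤ d) {β ρ : ℝ → ℝ} {L : ℝ → ℕ}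
    {μ : Measure (FieldConfig (EuclideanSpace ℝ (Fin d)))}
    (hβ : ∀ δ, 0 ≤ β δ) (hL : Tendsto (fun δ : ℝ => δ * L δ) (𝓝[>] 0) atTop)
    (hlim : TendstoInLaw (fun δ => isingFieldLaw d (β δ) L δ ρ) (𝓝[>] 0) μ)
    (hS : HasBoundedNondegenerateTwoPoint μ) (f : 𝓢(EuclideanSpace ℝ (Fin d), ℝ)) :
    Tendsto (fun δ : ℝ => ∑ x ∈ box d (L δ), |ρ δ * δ ^ d * f (δ • siteToE x)| *
        isingExpect (zdGraph d) (box d (L δ)) (β δ) 0 .plus (spinAt x)) (𝓝[>] 0) (𝓝 0) := by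
  obtain ⟨G, hG0, hGdom⟩ := exists_schwartz_soft_majorant f
  -- the eventual bound on `𝔪_δ(G)`
  have hevG := eventually_sq_plusMagnetization_le_of_tendstoInLaw hβ hlim hS.1 (g := G) hG0
  set B : ℝ := Real.sqrt (80 * (∫ ω, (ω G) ^ 2 ∂μ + 1)) with hB
  have hB0 : 0 ≤ B := Real.sqrt_nonneg _
  -- the sup bound on `f`
  set Cf : ℝ := SchwartzMap.seminorm ℝ 0 0 f with hCf
  have hCf0 : 0 ≤ Cf := apply_nonneg _ _
  have hfle : ∀ y, |f y| ≤ Cf := fun y => by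
    have h := SchwartzMap.le_seminorm ℝ 0 0 f y
    rwa [pow_zero, one_mul, norm_iteratedFDeriv_zero, Real.norm_eq_abs] at h
  have hδpos : ∀ᶠ δ in 𝓝[>] (0 : ℝ), 0 < δ := eventually_mem_nhdsWithin
  rw [Metric.tendsto_nhds]
  intro ε hε
  -- far region: `|f| ≤ ε' G` beyond radius `R`
  set ε' : ℝ := ε / (2 * (B + 1)) with hε'
  have hε'0 : 0 < ε' := by positivity
  have hε'B : ε' * B < ε / 2 := by
    rw [hε', div_mul_eq_mul_div, div_lt_div_iff₀ (by positivity) (by positivity)]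
    nlinarith
  obtain ⟨R, hR⟩ := hGdom ε' hε'0
  set R' : ℝ := max R 1 with hR'
  have hR'0 : 0 < R' := lt_of_lt_of_le one_pos (le_max_right _ _)
  -- near region
  have hnear := eventually_near_plusMagnetization_le hd hβ hL hlim hS hR'0
    (ε := ε / (2 * (Cf + 1))) (by positivity)
  have hevL : ∀ᶠ δ in 𝓝[>] (0 : ℝ), R' + 2 ≤ δ * L δ := hL.eventually_ge_atTop _
  have hδle : ∀ᶠ δ in 𝓝[>] (0 : ℝ), δ ≤ 1 :=
    (eventually_le_nhds one_pos).filter_mono nhdsWithin_le_nhds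
  filter_upwards [hevG, hnear, hevL, hδpos, hδle] with δ h1 h2 h3 hδ hδ1
  set Λ := box d (L δ) with hΛ
  set n : ℕ := ⌈R' / δ⌉₊ with hn
  set m : Site d → ℝ := fun x => isingExpect (zdGraph d) Λ (β δ) 0 .plus (spinAt x) with hm
  have hm0 : ∀ x ∈ Λ, 0 ≤ m x := fun x hx => isingExpect_plus_spinAt_nonneg (hβ δ) hx
  -- `box d n ⊆ Λ`
  have hnL : n ≤ L δ := by
    have hlt : (n : ℝ) < R' / δ + 1 := Nat.ceil_lt_add_one (by positivity)
    have h5 : δ * n < R' + δ := by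
      have := mul_lt_mul_of_pos_left hlt hδ
      rwa [mul_add, mul_div_cancel₀ _ hδ.ne', mul_one] at this
    have h' : (n : ℝ) < L δ := by
      by_contra hcon
      push Not at hcon
      have h4 : δ * L δ ≤ δ * n := mul_le_mul_of_nonneg_left hcon hδ.le
      linarith
    exact_mod_cast h'.le
  have hsub : box d n ⊆ Λ := box_mono d hnL
  -- the summand
  have hterm : ∀ x, |ρ δ * δ ^ d * f (δ • siteToE x)| * m x =
      |f (δ • siteToE x)| * (|ρ δ| * δ ^ d * m x) := fun x => by
    rw [abs_mul, abs_mul, abs_of_pos (pow_pos hδ d)]; ring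
  -- (i) near
  have hnear' : ∑ x ∈ box d n, |ρ δ * δ ^ d * f (δ • siteToE x)| * m x ≤ ε / 2 := by
    calc ∑ x ∈ box d n, |ρ δ * δ ^ d * f (δ • siteToE x)| * m x
        ≤ ∑ x ∈ box d n, Cf * (|ρ δ| * δ ^ d * m x) := Finset.sum_le_sum fun x hx => by
          rw [hterm]
          exact mul_le_mul_of_nonneg_right (hfle _)
            (mul_nonneg (by positivity) (hm0 x (hsub hx)))
      _ = Cf * (|ρ δ| * δ ^ d * ∑ x ∈ box d n, m x) := by rw [Finset.mul_sum, Finset.mul_sum]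
      _ ≤ Cf * (ε / (2 * (Cf + 1))) := mul_le_mul_of_nonneg_left h2 hCf0
      _ ≤ ε / 2 := by
          rw [mul_div_assoc', div_le_div_iff₀ (by positivity) (by positivity)]
          nlinarith
  -- (ii) far: outside `box d n` the continuum point is beyond radius `R`
  have hfar_pt : ∀ x ∈ Λ \ box d n, R ≤ ‖δ • siteToE x‖ := by
    intro x hx
    rw [Finset.mem_sdiff, mem_box (L := n)] at hx
    obtain ⟨i, hi⟩ := not_forall.1 hx.2
    have hi' : (n : ℤ) + 1 ≤ |x i| := by rw [le_abs]; omega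
    have hiR : (n : ℝ) + 1 ≤ |(x i : ℝ)| := by
      have h' : (((n : ℤ) + 1 : ℤ) : ℝ) ≤ ((|x i| : ℤ) : ℝ) := by exact_mod_cast hi'
      simpa [Int.cast_abs] using h'
    have hnR : R' / δ ≤ n := Nat.le_ceil _
    calc R ≤ R' := le_max_left _ _
      _ = δ * (R' / δ) := by field_simp
      _ ≤ δ * ((n : ℝ) + 1) := mul_le_mul_of_nonneg_left (by linarith) hδ.le
      _ ≤ δ * |(x i : ℝ)| := mul_le_mul_of_nonneg_left hiR hδ.le
      _ = |(δ • siteToE x) i| := by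
          rw [PiLp.smul_apply, siteToE_apply, smul_eq_mul, abs_mul, abs_of_pos hδ]
      _ ≤ ‖δ • siteToE x‖ := by simpa using PiLp.norm_apply_le (δ • siteToE x) i
  have hMG : ∑ x ∈ Λ, |ρ δ| * δ ^ d * G (δ • siteToE x) * m x ≤ B := by
    have hnn : 0 ≤ ∑ x ∈ Λ, |ρ δ| * δ ^ d * G (δ • siteToE x) * m x :=
      Finset.sum_nonneg fun x hx => mul_nonneg (mul_nonneg (by positivity) (hG0 _)) (hm0 x hx)
    have h := Real.abs_le_sqrt h1
    rwa [abs_of_nonneg hnn] at h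
  have hfar' : ∑ x ∈ Λ \ box d n, |ρ δ * δ ^ d * f (δ • siteToE x)| * m x ≤ ε' * B := by
    calc ∑ x ∈ Λ \ box d n, |ρ δ * δ ^ d * f (δ • siteToE x)| * m x
        ≤ ∑ x ∈ Λ \ box d n, ε' * (|ρ δ| * δ ^ d * G (δ • siteToE x) * m x) :=
          Finset.sum_le_sum fun x hx => by
            rw [hterm]
            have hmx := hm0 x (Finset.mem_sdiff.1 hx).1
            calc |f (δ • siteToE x)| * (|ρ δ| * δ ^ d * m x)
                ≤ ε' * G (δ • siteToE x) * (|ρ δ| * δ ^ d * m x) :=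
                  mul_le_mul_of_nonneg_right (hR _ (hfar_pt x hx)) (by positivity)
              _ = ε' * (|ρ δ| * δ ^ d * G (δ • siteToE x) * m x) := by ring
      _ = ε' * ∑ x ∈ Λ \ box d n, |ρ δ| * δ ^ d * G (δ • siteToE x) * m x := by rw [Finset.mul_sum]
      _ ≤ ε' * ∑ x ∈ Λ, |ρ δ| * δ ^ d * G (δ • siteToE x) * m x := by
          refine mul_le_mul_of_nonneg_left (Finset.sum_le_sum_of_subset_of_nonneg Finset.sdiff_subset
            fun x hx _ => mul_nonneg (mul_nonneg (by positivity) (hG0 _)) (hm0 x hx)) hε'0.le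
      _ ≤ ε' * B := mul_le_mul_of_nonneg_left hMG hε'0.le
  -- assemble
  have htot : ∑ x ∈ Λ, |ρ δ * δ ^ d * f (δ • siteToE x)| * m x < ε := by
    rw [← Finset.sum_sdiff hsub]
    linarith
  have hnn : 0 ≤ ∑ x ∈ Λ, |ρ δ * δ ^ d * f (δ • siteToE x)| * m x :=
    Finset.sum_nonneg fun x hx => mul_nonneg (abs_nonneg _) (hm0 x hx)
  rw [Real.dist_eq, sub_zero, abs_of_nonneg hnn]
  exact htot

/-- **crit-ising.S13 (high-dimensional triviality) for `d ≥ 5`, in the plus-box rendering of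
`Literature.Probability.LatticeModels.highDim_triviality` — unconditional.** For the
nearest-neighbour Ising model on `ℤᵈ`, `d ≥ 5`: for any renormalisation `ρ`, box sides `L(δ)`
with `δ L(δ) → ∞` and inverse temperatures `0 ≤ β(δ) ≤ β_c`, every limit in law `μ` (`δ → 0⁺`) of
the rescaled spin field `Φ_δ(f) = ρ(δ) δᵈ ∑ₓ f(δx) σₓ` smeared under the FINITE-VOLUME PLUS
measures `μ⁺_{box d (L δ); β(δ), 0}`, whose two-point function is bounded by `C‖x−y‖^{−(d−2)}`
and non-degenerate, is a centred Gaussian field. Literally the body of `highDim_triviality`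
restricted to `5 ≤ d`. Proof: the plus-boundary magnetisation functional vanishes under these
hypotheses (`tendsto_plusBoundaryMagnetization_of_tendstoInLaw`), so the plus-box laws have the
same limits in law as the infinite-volume laws (`highDim_triviality_plus_of_five_le`), to which
Aizenman's theorem applies (Aizenman, CMP 86 (1982), Prop. 10.1 with (13.1); Fröhlich 1982;
Panis 2023, Thm 5.5; `highDim_triviality_gibbs_of_five_le`).
[cite: AizenmanCMP1982, Prop. 10.1 (p. 28) with (13.1) (p. 39)] [cite: Panis2023Triviality, Thm. 5.5 and Thm. 1.2] [cite: MessagerMiracleSoleJSP1977, main theorem (monotonicity of ⟨σ₀σ_x⟩ under reflections)] -/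
theorem highDim_triviality_of_five_le :
    ∀ (d : ℕ) (_ : 5 ≤ d),
      ∀ (ρ : ℝ → ℝ) (L : ℝ → ℕ) (β : ℝ → ℝ)
        (μ : Measure (FieldConfig (EuclideanSpace ℝ (Fin d)))),
        (∀ δ, 0 ≤ β δ ∧ β δ ≤ criticalBeta d) →
        Tendsto (fun δ : ℝ => δ * L δ) (𝓝[>] 0) atTop →
        TendstoInLaw (fun δ => isingFieldLaw d (β δ) L δ ρ) (𝓝[>] 0) μ →
        HasBoundedNondegenerateTwoPoint μ → IsGaussianField μ :=
  fun d hd ρ L β μ hβ hL hlim hS =>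
    highDim_triviality_plus_of_five_le d hd ρ L β μ hβ hL
      (fun f => tendsto_plusBoundaryMagnetization_of_tendstoInLaw (by omega) (fun δ => (hβ δ).1) hL
        hlim hS f) hlim hS

/-- **crit-ising.S13 for `d ≥ 4`, in the plus-box rendering of `highDim_triviality`, from the
single named fact `panis_ursellFourSum_le_four`** (Aizenman–Duminil-Copin, Ann. Math. 194 (2021)
= arXiv:1912.07973, Thm 1.2 with Def. 1.1 (p. 4), Prop. 1.4 (p. 6), at `d = 4` through Panis 2023,
Cor. 1.8). Literally the body of `Literature.Probability.LatticeModels.highDim_triviality`; the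
named fact enters at `d = 4` only (the `d ≥ 5` case is `highDim_triviality_of_five_le`). When
`panis_ursellFourSum_le_four_holds` lands, `highDim_triviality` itself is this theorem applied to
it. [cite: AizenmanDuminilCopinAnnals2021, Thm 1.2 with Def. 1.1 (p. 4), §1.3 (p. 5), Prop. 1.4 (p. 6), §6.3 (p. 26)] [cite: Panis2023Triviality, Cor. 1.8 and Thm. 5.5] -/
theorem highDim_triviality_of_panisFour (hP₄ : panis_ursellFourSum_le_four) :
    ∀ (d : ℕ) (_ : 4 ≤ d),
      ∀ (ρ : ℝ → ℝ) (L : ℝ → ℕ) (β : ℝ → ℝ)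
        (μ : Measure (FieldConfig (EuclideanSpace ℝ (Fin d)))),
        (∀ δ, 0 ≤ β δ ∧ β δ ≤ criticalBeta d) →
        Tendsto (fun δ : ℝ => δ * L δ) (𝓝[>] 0) atTop →
        TendstoInLaw (fun δ => isingFieldLaw d (β δ) L δ ρ) (𝓝[>] 0) μ →
        HasBoundedNondegenerateTwoPoint μ → IsGaussianField μ :=
  fun d hd ρ L β μ hβ hL hlim hS =>
    highDim_triviality_plus hP₄ d hd ρ L β μ hβ hL
      (fun f => tendsto_plusBoundaryMagnetization_of_tendstoInLaw (by omega) (fun δ => (hβ δ).1) hL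
        hlim hS f) hlim hS


/-- **crit-ising.S13 (`highDim_triviality`) from the single named fact `panis_ursellFourSum_le_four`.**
The tree's statement `Literature.Probability.LatticeModels.highDim_triviality` (all `d ≥ 4`, plus
boxes in the joint regime) follows from `highDim_triviality_of_panisFour`; the named fact (Panis
2023, Cor. 1.8 = Aizenman–Duminil-Copin 2021, Thm 1.3, the `d = 4` multiscale improvement of the
tree diagram bound) enters at `d = 4` only, the case `d ≥ 5` being the unconditional
`highDim_triviality_of_five_le`. The discharge `highDim_triviality_holds` is this theorem applied
to `panis_ursellFourSum_le_four_holds` once that fact lands.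
[cite: AizenmanDuminilCopinAnnals2021, Thm 1.2 with Def. 1.1 (p. 4), Thm 1.3 (p. 6)] [cite: Panis2023Triviality, Cor. 1.8 and Thm. 5.5] -/
theorem highDim_triviality_of_panis (hP₄ : panis_ursellFourSum_le_four) : highDim_triviality :=
  highDim_triviality_of_panisFour hP₄

/-- **crit-ising.S13 (`highDim_triviality`) granting the uniform smallness of the Ursell sum** —
the hypothesis-explicit form of the `d ≥ 4` assembly: if for every `d ≥ 4`, `r ≥ 1`, `ε > 0`
there is `L₀` with `Σ_L⁻² ∑_{Λ_{rL}⁴} |U₄^μ| ≤ ε` for all `L ≥ L₀`, `0 ≤ β ≤ β_c(d)`, `μ ∈ 𝒢(β, 0)`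
(the quantity through which Aizenman 1982, Prop. 10.1, and Aizenman–Duminil-Copin 2021, Prop. 1.4
/ §6.3, control the deviation from Wick's rule; for `d ≥ 5` this is the tree's theorem
`ursellFourSum_uniformlySmall_of_five_le`, at `d = 4` it is what Thm 1.3 of ADC 2021 / Cor. 1.8 of
Panis 2023 provide), then the plus-box rendering `highDim_triviality` holds: the plus-boundary
magnetisation functional vanishes (`tendsto_plusBoundaryMagnetization_of_tendstoInLaw`) and the
core `isGaussianField_of_tendstoInLaw_isingFieldLaw` of `FieldScalingLimitPlusBoxProofs` applies.
The three doors below specialise `hU` to the tree's `d = 4` named facts.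
[cite: AizenmanDuminilCopinAnnals2021, Thm 1.2 with Def. 1.1 (p. 4), Prop. 1.4 (p. 6), §6.3 (pp. 26–27)] [cite: AizenmanCMP1982, Prop. 10.1 (p. 28) with (13.1) (p. 39)] -/
theorem highDim_triviality_of_ursellFourSum_uniformlySmall
    (hU : ∀ {d : ℕ}, 4 ≤ d → ∀ r : ℝ, 1 ≤ r → ∀ ε : ℝ, 0 < ε → ∃ L₀ : ℝ,
      ∀ (β L : ℝ), 0 ≤ β → β ≤ criticalBeta d → L₀ ≤ L →
      ∀ μ ∈ isingGibbsMeasures d β 0, ursellFourSum μ L r ≤ ε) :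
    highDim_triviality :=
  fun _ hd _ _ _ _ hβ hL hlim hS =>
    isGaussianField_of_tendstoInLaw_isingFieldLaw hd (hU hd) hβ hL
      (fun f => tendsto_plusBoundaryMagnetization_of_tendstoInLaw (by omega) (fun δ => (hβ δ).1) hL
        hlim hS f) hlim

/-- **crit-ising.S13 (`highDim_triviality`) from the summed `d = 4` bound of Aizenman–Duminil-Copin
2021, §6.3** (the named fact `aizenmanDuminilCopin_ursellFourSum_le` of `HighDimTrivialityMoments`:
`Σ_L⁻² ∑_{Λ_{rL}⁴} |U₄| ≤ C r¹² (log L)^{-c}` at `β = β_c` or in the window `L ≤ ξ(β)`), through the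
tree's synthesis `ursellFourSum_uniformlySmall_of_adc` (`HighDimTrivialityCorrLengthWindow`: the
window bound, the plain tree diagram bound outside the window, and `d ≥ 5`).
[cite: AizenmanDuminilCopinAnnals2021, Thm 1.2 (p. 4), Prop. 1.4 (p. 6), §6.3 (pp. 26–27)] -/
theorem highDim_triviality_of_adcUrsellFourSum (hS₄ : aizenmanDuminilCopin_ursellFourSum_le) :
    highDim_triviality :=
  highDim_triviality_of_ursellFourSum_uniformlySmall
    (fun hd r hr ε hε => ursellFourSum_uniformlySmall_of_adc hS₄ hd r hr ε hε)

/-- **crit-ising.S13 (`highDim_triviality`) from Aizenman–Duminil-Copin 2021, Theorem 1.3 alone**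
(the improved tree diagram bound, the named fact
`Literature.Probability.LatticeModels.aizenmanDuminilCopin_improvedTreeDiagramBound` — the one
printed `d = 4` input left: the §6.3 summation is the tree's theorem
`aizenmanDuminilCopin_ursellFourSum_le_of_facts`, fed with the sliding-scale infrared bound,
Thm 5.6, proved as `aizenmanDuminilCopin_slidingScaleInfraredBound_holds`). Since
`panis_ursellFourSum_le_four` is itself reduced to Theorem 1.3 in the tree
(`panis_ursellFourSum_le_four_of_improvedTreeDiagramBound`), this is the shortest door: the
discharge `highDim_triviality_holds` is this theorem applied to
`aizenmanDuminilCopin_improvedTreeDiagramBound_holds` once Theorem 1.3 is proved (equivalently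
`highDim_triviality_of_panis panis_ursellFourSum_le_four_holds`).
[cite: AizenmanDuminilCopinAnnals2021, Thm 1.2 (p. 4), Thm 1.3 (p. 6), Thm 5.6 (p. 18), §6.3 (pp. 26–27)] -/
theorem highDim_triviality_of_improvedTreeDiagramBound
    (h13 : aizenmanDuminilCopin_improvedTreeDiagramBound) : highDim_triviality :=
  highDim_triviality_of_adcUrsellFourSum
    (aizenmanDuminilCopin_ursellFourSum_le_of_facts h13
      aizenmanDuminilCopin_slidingScaleInfraredBound_holds)

end Assembly

end Literature.Probability.LatticeModels
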